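import Literature.MathematicalPhysics.QuantumFieldTheory.Balaban1983to89.Node00.N24ItemsStage13AtThm1CCMOfStepRSepCoPH
import Summits.QuantumFields.YangMills.Theorems.BalabanUVNodesK0ROfStepTokensRCubeB
import Summits.QuantumFields.YangMills.Theorems.BalabanUVNodesN07Thm1Top7FromProp8GuardedB

/-!
# NODE N24 AT THE V15 K0⁷ WITNESS WITH THE K0 SIDE OPENED TO EXACTLY plan g76's V15 STUB BODIES (`N = 2`, `j = 3`): K1⁷'s θ-KEYED CONSEQUENT AND THE REGISTERED RUNG BODIES AT THE
# HISTORY-BLIND DOOR OVER THE CURED RESIDUAL OF THE CUBE WITNESS `θ₁₅ᶜᶜᴹ(3; ε₀, ε₂₉; B₃, B₃', a₀, a₁')`, the door provisos `hP` DISCHARGED BY NAME modulo [15] Prop. 8's top step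
# (stub 1 `Prop8StepCoPAt F` opened), [6] Prop. 6 at NODE 00's member (stub 2 `Prop6MemberB8At F` opened), the thresholds + window-½ β-box (stub 3′ `BetaBoxAtThm1WitnessCCMAt F`'s
# ∃-body opened) and `4 ≤ F.m` ((δ)) — for any gauge constant `B₃' ≥ b9Of F L³ B₁ · B₃` and ceiling `0 < a₁' ≤ min a₁ (a0Of F 2 L³ B₁ c₁ ∕ B₃)` (V15's exact letters by `le_rfl`)

STAGE-2 SIBLING (dag-n24-c g20; director-ym №365 (2) ∕ №366 R1–R6; S2-campaign row 10 Thm, TIER 2 «post-seam additive»): this module is the ᴮ SIBLING `…N24AtThm1CCMDoorOfStepTokensB` of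
`Thm/BalabanUVNodesN24AtThm1CCMDoorOfStepTokens` (same six short declaration names, new namespace ⇒ new FQNs; the old module is NOT touched and is RESIDUE after the Stage-2 seam —
red on its own text, not false).  Every displayed [15] Prop-8 top-step token is now the GUARDED `(bd, Dat)` ᴮ token at the cube floor `floorGuard F ((11·4+3·L)·L)`, print's bond datum
`lamDatum F` ([14] (2.3)) and the (7)-data predicate of record `dataSmall7PTopOf F 2`: `Prop8RegSepTopStepGB F 2 suppDom (floorGuard F ((11·4+3·L)·L)) (lamDatum F) (dataSmall7PTopOf F 2) B₃ a₀ a₁`;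
the suppliers are the ᴮ names — dag-n07 53′ `N07Thm1Top7FromProp8GuardedB.variationalThm1RegSepCoP7MGB_of_prop8TopStepGB_lamDatum` ((8)ᴮ from the guarded top step at print's datum),
S1b `variationalThm1GaugeRegSepCoP7MGB_of_gauge9TopStepGB`, k0-s1-w3's F1B `K0ROfStepTokensRCubeB.gauge9R_cube_of_prop8TopStep_of_prop6Member` (FILE C's cube arithmetic, ᴮ currency) — and
row 10's in-place re-keyed `Node00/N24ItemsStage13AtThm1CCMOfStepRSepCoPH` door (chain B by node00-def-T).  The prose «(8) ∕ the R gauge sentence ∕ the R (9)-step» below denotes these ᴮ tokens;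
proofs are otherwise verbatim.  Re-keying bookkeeping only — nothing of Bałaban asserted. [14] = [Balaban1984PropagatorsII].

TRACK A (YM-PLAN §2d, node N24 of 28 = binder B2 `hB : B16.EndStatementBPrinted D.C`), seat `pub-ymgap-dag-n24-c` (R134 fan-out seat, strategy s2; gen 7).  Key of record: K1⁷
`StabilityBAtRecordR13SepCoPH` = stmt-QuantumFields-20542; this file `--supports` it as a helper (Summits lane: it imports dag-n21-c's FILE C `BalabanUVNodesK0ROfStepTokensRCube` and,
through it, dag-n07-e's bridge `BalabanUVNodesN07Thm1Top7FromProp8`).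
WHY (plan g76 (δ)-WORD + V15 §(4), INBOX l.21568; kit `pub-ymgap-plan/D76-K0V15/K0Skeleton13SepCoPHV15.lean` 7a515a944d49c6af): V15 composes K0⁷ `Record13SepCoPHInhabited` on print's
range `4 ≤ F.m` from stub 1 `Prop8StepCoPAt F` (∃ B₃ a₀ a₁, 2L² ≤ B₃ ∧ 0 < a₀ ∧ 0 < a₁ ∧ `Prop8RegSepTopStepGB F 2 suppDom (floorGuard F ((11·4+3·L)·L)) (lamDatum F) (dataSmall7PTopOf F 2) B₃ a₀ a₁`), stub 2 `Prop6MemberB8At F` (∃ B₁ c₁, 0 ≤ B₁ ∧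
0 < c₁ ∧ `B8.Prop6Printed 4 L B₁ c₁ (zdCub (MatA 2) L ·)`) and stub 3′ `BetaBoxAtThm1WitnessCCMAt F` (thresholds `ε₀ ε₂₉ > 0` and the window-½ box of `betaOfRecord₁₃ F 2 θ₁₅ᶜᶜᴹ(3; …)`)
through FILE C's ABSTRACT closer `exists_k0H_of_prop8TopStep_of_prop6Member_of_betaBox : … → ∃ θ, Provisos ∧ …` (a decl of the RESIDUE module `…K0ROfStepTokensRCube`, not of F1B′ — named here as history only), at the letters `B₃' := b9Of F L³ B₁ · B₃`, `a₁' := min a₁ (a0Of F 2 L³ B₁ c₁ ∕ B₃)`.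
The K1⁷ closer working AT that witness needs `hP` POINTED (Part 6 `N24ItemsStage13AtThm1CCMOfStepRSepCoPH` opened it to the two SENTENCES); §0 here opens it further to the STUB BODIES —
V15's own `Record13SepCoPHInhabited_of` chain kept POINTED: Prop. 8 ⇒ (8) at the shrunk ceiling by dag-n07-e's `variationalThm1RegSepCoP7MGB_of_prop8TopStepGB_lamDatum` (`Prop8RegSepTopStepGB.of_le`),
Prop. 8 ∧ Prop. 6 ⇒ the R (9)-step at `(L³, (11·4+3L)·L; B₃, b9Of·B₃, a₀, min a₁ (a0Of∕B₃))` by FILE C's `gauge9R_cube_of_prop8TopStep_of_prop6Member` ⇒ the (9)-line-1 sentence by B′'s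
`variationalThm1GaugeRegSepCoP7MGB_of_gauge9TopStepGB`, weakened to `(B₃', a₁')` by B′'s `.mono ∕ .of_le`; collar `(11·4+3L)·L ≤ L³ = ν.M₁` by A2's `collar_le_M₁_theta13OfThm1CCM`; then
FILE B's pointed `provisos₁₃SepCoP_theta13OfThm1CCM_of_thm1GaugeR` at `j := 3`, `hjm := hm`, through the two doors.  §2 = Part 5 §2's five door forms at `N := 2`, `j := 3` with `hP := §0`.
TYPING NOTE: the witness letters are ATOMIC (`B₃'`, `a₁'` + the two inequalities): with the compound choices written inside `theta13OfThm1CCM F 2 3 …` the S-bound H-pinned view's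
`ops` binder puts a `whnf` over the cliff (2·10⁵ heartbeats) in the three `pinX3HS` statements — the same class as the nested-pin gotcha; atomic letters elaborate in seconds.
So «WHICH CHILD BLOCKS K1⁷», kernel form (§2 rung-1 hypothesis list): K0 side = V15's three printed stubs' BODIES + `4 ≤ F.m`; then the world S-bound to the H-pinned (or X-rebound)
four-pin view (letters free); N05 ∕ N06 ∕ N07 ∕ N08 ∕ N09 (+ `h09T`) ∕ N10 ∕ N11 (S1ᵀ) ∕ N12 leaves; N13's (UV₁₃); and (consequent ∕ rung 2) the WORLD's β-box letters `hlo ∕ hhi`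
(at `w.γ = ½ = θ₁₅ᶜᶜᴹ.γ`, `w.b = b`, `w.βup = β'` they ARE stub 3′'s `hbox ∕ hbox'`).
A NEW importing module (imports Part 6 + FILE C).  THEOREMS ONLY, def-free, sorry-free, standard axioms; every §2 proof is ONE application of the Part 5 door theorem at `N := 2`.

WHAT THIS FILE PROVES (6 theorems).  §0 `N24_provisos₁₃SepCoPH_door_theta13OfThm1CCM_cube_of_prop8TopStep_of_prop6Member_of_betaBox`.  §2 `N24_stabilityBR13SepCoPH_thetaShape20_rebindX_fourPin_pointed_theta13OfThm1CCM_cube_of_prop8TopStep_of_prop6Member_of_betaBox_door`,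
`N24_betaWindowAtSomeRecord₁₃SepCoPH_of_rebindX_fourPin_pointed_of_boxH_theta13OfThm1CCM_cube_of_prop8TopStep_of_prop6Member_of_betaBox_door`, `N24_stabilityBR13SepCoPH_thetaShape20_pinX3HS_fourPin_pointed_theta13OfThm1CCM_cube_of_prop8TopStep_of_prop6Member_of_betaBox_door`,
`N24_nodesAtSomeRecordS₁₃SepCoPH_of_pinX3HS_fourPin_pointed_theta13OfThm1CCM_cube_of_prop8TopStep_of_prop6Member_of_betaBox_door` (rung 1; at `N = 2` its conclusion is the registered v5 text `NodesAtSomeRecord13PWS F`'s body),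
`N24_betaWindowAtSomeRecordS₁₃SepCoPH_of_pinX3HS_fourPin_pointed_of_boxH_theta13OfThm1CCM_cube_of_prop8TopStep_of_prop6Member_of_betaBox_door` (rung 2; `BetaWindowAtSomeRecord13S F`'s body).

HONEST FRAMING: composition BY NAME; nothing of Bałaban's asserted — [15] Prop. 8's top step, [6] Prop. 6 at the member, the β-box, every child leaf and `4 ≤ F.m` are DISPLAYED hypotheses;
K0⁷ ∕ K1⁷ NOT closed; N24 COMPOSITE — no discharge, no count moved (5∕27), no stub closed; one finite T⁴ programme at fixed ε; NOT continuum ∕ ℝ⁴ ∕ OS ∕ mass gap ∕ Clay.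
-/

noncomputable section

open scoped Matrix.Norms.L2Operator

namespace Summit.QuantumFields.YangMills.BalabanUVNodes.N24AtThm1CCMDoorOfStepTokensB

open Literature.MathematicalPhysics.QuantumFieldTheory.Balaban1983to89
open Literature.MathematicalPhysics.QuantumFieldTheory.Balaban1983to89.Node00
open DagBinding T4Continuum T4DatumAssembly FlowStepRuns AveragingRT
open FlowStep (BetaLowerH BetaUpperH)
open Summit.QuantumFields.YangMills.BalabanUVNodes.N07Thm1Top7FromProp8GuardedB (variationalThm1RegSepCoP7MGB_of_prop8TopStepGB_lamDatum)
open Summit.QuantumFields.YangMills.Theorems.K0ROfStepTokensRCubeB (gauge9R_cube_of_prop8TopStep_of_prop6Member)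

variable {F : T4Family}

/-! ## §0. The door provisos at the cube witness POINTED, from V15's stub bodies (FILE C's arithmetic + dag-n07-e's bridge + FILE B) -/

/-- **★★ THE v1.7 DOOR PROVISOS AT THE CUBE WITNESS `θ₁₅ᶜᶜᴹ(3; ε₀, ε₂₉; B₃, B₃', a₀, a₁')`, `N = 2`, ON PRINT's RANGE `4 ≤ F.m`, POINTED, FROM EXACTLY V15's STUB BODIES**:
[15] Prop. 8's top step at `(B₃, a₀, a₁)` with the floor `2L² ≤ B₃` and `0 < a₀` (stub 1; its `0 < a₁` is not needed once the ceiling is shrunk to `a₁' ≤ a₁`), [6] Prop. 6 at NODE 00's member `(B₁, c₁)` (stub 2), thresholds `0 < ε₀`, `0 < ε₂₉` and the window-½ β-box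
`(b, β')` with `0 ≤ b`, `β' ≤ 3` (stub 3′'s body), `4 ≤ F.m` ((δ)) — for ANY gauge constant `B₃' ≥ b9Of F L³ B₁ · B₃` and ANY ceiling `0 < a₁' ≤ min a₁ (a0Of F 2 L³ B₁ c₁ ∕ B₃)`
(V15's exact letters with `le_rfl`; the letters are kept ATOMIC in the statement — the compound choices inside the witness put the pinned-view defeq over the `whnf` cliff).  V15's
`Record13SepCoPHInhabited_of` chain kept POINTED: Prop. 8 ⇒ (8) at `a₁'` by dag-n07-e's bridge (ceiling shrunk by `Prop8RegSepTopStepGB.of_le`), Prop. 8 ∧ Prop. 6 ⇒ the R (9)-step at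
`(L³, (11·4+3L)·L; B₃, b9Of·B₃, a₀, min a₁ (a0Of∕B₃))` by FILE C's `gauge9R_cube_of_prop8TopStep_of_prop6Member` ⇒ the (9)-line-1 sentence `VariationalThm1GaugeRegSepCoP7MGB` (B′
`variationalThm1GaugeRegSepCoP7MGB_of_gauge9TopStepGB`) weakened to `(B₃', a₁')` by B′'s `.mono ∕ .of_le`; collar `(11·4+3L)·L ≤ L³ = ν.M₁` by A2's `collar_le_M₁_theta13OfThm1CCM`; then
FILE B's pointed `provisos₁₃SepCoP_theta13OfThm1CCM_of_thm1GaugeR` at `j := 3`, `hjm := hm`, through the two doors.  CONDITIONAL on every displayed hypothesis; nothing of Bałaban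
asserted; K0⁷ NOT closed here.
[cite: Balaban1985Variational, Thm 1 (8)–(9) p.279, (144)–(152) pp.300–301, Prop. 8 p.304; Balaban1985RegularSpaces, (1.3)–(1.9) p.77, Prop. 6 p.99; Balaban1988Convergent, Thm 1 p.262, (2.4)–(2.8) pp.255–256, (2.12)–(2.13) p.256, (2.21) p.258, (3.16)–(3.23) pp.268–270; Balaban1987RG1, (0.1) p.251, (1.11)–(1.12) p.262, §1 p.264; Balaban1989LargeFieldI, (0.2)–(0.4) p.176] -/
theorem N24_provisos₁₃SepCoPH_door_theta13OfThm1CCM_cube_of_prop8TopStep_of_prop6Member_of_betaBox (F : T4Family) (hm : 4 ≤ F.m) {B₃ a₀ a₁ B₁ c₁ B₃' a₁' : ℝ}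
    (hB₃ : 2 * (F.L : ℝ) ^ 2 ≤ B₃) (ha₀ : 0 < a₀)
    (h8 : Prop8RegSepTopStepGB F 2 (fun ν K Ω => suppDomOfRecord F ν K Ω) (floorGuard F ((11 * 4 + 3 * F.L) * F.L)) (lamDatum F) (dataSmall7PTopOf F 2) B₃ a₀ a₁) (hB₁ : 0 ≤ B₁) (hc₁ : 0 < c₁)
    (hP6 : letI : CStarAlgebra (MatA 2) := {}; B8.Prop6Printed 4 (F.L : ℝ) B₁ c₁ (fun i : B8LeafModelZd.ZdIdx 4 F.L => zdCub (MatA 2) F.L i))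
    (hB₉ : b9Of F (F.L ^ 3) B₁ * B₃ ≤ B₃') (ha₁' : 0 < a₁') (ha₁'le : a₁' ≤ min a₁ (a0Of F 2 (F.L ^ 3) B₁ c₁ / B₃))
    {ε₀ ε₂₉ b β' : ℝ} (hε : 0 < ε₀) (hε' : 0 < ε₂₉) (hb : 0 ≤ b)
    (hbox : BetaLowerH b (1 / 2) (betaOfRecord₁₃ F 2 (theta13OfThm1CCM F 2 3 ε₀ ε₂₉ B₃ B₃' a₀ a₁')))
    (hbox' : BetaUpperH β' (1 / 2) (betaOfRecord₁₃ F 2 (theta13OfThm1CCM F 2 3 ε₀ ε₂₉ B₃ B₃' a₀ a₁'))) (hβ' : β' ≤ 3) :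
    (Stage13HParams.ofHistoryBlind F 2 ⟨theta13OfThm1CCM F 2 3 ε₀ ε₂₉ B₃ B₃' a₀ a₁', ZrOfRecord₁₃ F 2 (theta13OfThm1CCM F 2 3 ε₀ ε₂₉ B₃ B₃' a₀ a₁')⟩).Provisos₁₃SepCoPH F 2 := by
  have hL0 : (0 : ℝ) < (F.L : ℝ) := by exact_mod_cast lt_trans Nat.zero_lt_one F.hL.2
  have hBpos : (0 : ℝ) < B₃ := lt_of_lt_of_le (mul_pos two_pos (pow_pos hL0 2)) hB₃
  have hB9 : (0 : ℝ) ≤ B₃' := (mul_nonneg (b9Of_pos (F := F) (F.L ^ 3) hB₁).le hBpos.le).trans hB₉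
  exact (provisos₁₃SepCoP_theta13OfThm1CCM_of_thm1GaugeR (N := 2) (j := 3) hm hε hε' hBpos.le hB9 ha₀ ha₁'
    (variationalThm1RegSepCoP7MGB_of_prop8TopStepGB_lamDatum hBpos (h8.of_le le_rfl (ha₁'le.trans (min_le_left _ _))))
    ((theta13OfThm1CCM_M₁ F 2 3 ε₀ ε₂₉ B₃ B₃' a₀ a₁') ▸ collar_le_M₁_theta13OfThm1CCM F 2 ε₀ ε₂₉ B₃ B₃' a₀ a₁' (le_refl 3))
    (((variationalThm1GaugeRegSepCoP7MGB_of_gauge9TopStepGB (gauge9R_cube_of_prop8TopStep_of_prop6Member F hBpos h8 hB₁ hc₁ hP6)).mono hB₉).of_le le_rfl ha₁'le)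
    (hmono_theta13OfThm1CCM_of_betaLowerH hb hbox) (hcompRev_theta13OfThm1CCM_of_betaBox hBpos.le hB9 ha₀.le ha₁'.le hb hbox hbox' hβ')).ofCured.ofHistoryBlind


/-! ## §2. `N = 2`, `j = 3`, the cube letters kept atomic: `hP` ⟸ EXACTLY V15's stub bodies (Prop. 8 top step, Prop. 6 at the member, thresholds + β-box) + `4 ≤ F.m` -/

/-- **AT THE V15 WITNESS ON PRINT's RANGE `4 ≤ F.m`, `N = 2`, `j = 3`, WITH `hP` DISCHARGED MODULO EXACTLY plan g76's V15 STUB BODIES** — [15] Prop. 8's top step `Prop8RegSepTopStepGB F 2 suppDom (floorGuard F ((11·4+3·L)·L)) (lamDatum F) (dataSmall7PTopOf F 2) B₃ a₀ a₁` with `2L² ≤ B₃`, `0 < a₀`, `0 < a₁` (stub 1 `Prop8StepCoPAt F` opened), [6] Prop. 6 at NODE 00's member `B8.Prop6Printed 4 L B₁ c₁ (zdCub (MatA 2) L ·)` with `0 ≤ B₁`, `0 < c₁` (stub 2 `Prop6MemberB8At F` opened), the thresholds `0 < ε₀`, `0 < ε₂₉` and the β-box at the cube witness `θ₁₅ᶜᶜᴹ(3;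 ε₀, ε₂₉; B₃, B₃', a₀, a₁')` for ANY gauge constant `B₃' ≥ b9Of·B₃` and ceiling `0 < a₁' ≤ min a₁ (a0Of∕B₃)` (V15's exact letters `B₃' := b9Of F L³ B₁ · B₃`, `a₁' := min a₁ (a0Of F 2 L³ B₁ c₁ ∕ B₃)` with `le_rfl`; stub 3′ `BetaBoxAtThm1WitnessCCMAt F`'s ∃-body opened) and `hm : 4 ≤ F.m` ((δ)); door provisos BY NAME (§0) through dag-n07-e's bridge `variationalThm1RegSepCoP7MGB_of_prop8TopStepGB_lamDatum`, dag-n21-c FILE C's `gauge9R_cube_of_prop8TopStep_of_prop6Member` and B′'s monotonicity `VariationalThm1GaugeRegSepCoP7MGB.mono ∕ .of_le` — AT THE V15 WITNESS `Stage13HParams.ofHistoryBlind ⟨θ₁₅ᶜᶜᴹ, ZrOfRecord₁₃ θ₁₅ᶜᶜᴹ⟩` (the history-blind door over the cured residual of the collared `θ₁₅ᶜᶜᴹ(j) = theta13OfThm1CCM F N j ε₀ ε₂₉ B₃ B₃' a₀ a₁`; `= ofHistoryBlind (Stage13RParams.ofCured θ₁₅ᶜᶜᴹ)`, `rfl`)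 — ITEM K1⁷'s θ-KEYED CONSEQUENT WITNESSED BY `(θ, hP)` FROM THE POINTED CHILDREN OVER THE X-REBOUND FOUR-PIN VIEW** (§1 into def-T's
`endStatementBPrinted_of_isRecordOfRecord₁₃CCoPH_of_nodes` + module 38's interval β-binder + module 26's window).  COMPOSITE.
[cite: Balaban1989LargeFieldII, Thm 1 p.355, (0.1) pp.355–356, p.391; Balaban1988Convergent, (3.16)–(3.22) pp.268–269; Balaban1987RG1, Thm 3 p.264, (0.17)–(0.20) pp.255–256 and (1.22) p.264, (2.9) p.266; Balaban1985UV3, Thm 1 p.257 (bookkeeping + elementary window)] (= `N24_stabilityBR13SepCoPH_thetaShape20_rebindX_fourPin_pointed` at `θ := the door`; `Admissible` ← dag-n21-c `admissible_theta13OfThm1CCM` (six signs), `SlotsNondegenerate₁₃` ← dag-n21-c `slotsNondegenerate₁₃_theta13OfThm1CCM` (hypothesis-free), N13's (R₁₃) ← §0 `N24_laws₁₃CoPH_theta13OfThm1CCM` (= dag-n11-e's generic `rOpLeaf_VOfRecord₁₃CoPH_theta13LiveOfNumerics` at the member, six signs) — ALL BY NAME; the β-box pair `hlo ∕ hhi`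 read at the witness's β of record `betaOfRecord₁₃ F N θ₁₅ᶜᶜᴹ` (def-T `βfun_datumOfRecord₁₃SepCoPH`, `rfl`) = the currency of V15's stub 3′ `stub_betaBoxAtThm1WitnessCCM13` (there at `j = 3`, γ = 1∕2 = `θ₁₅ᶜᶜᴹ.γ`); the unity guard DISCHARGED by `Stage13RParams.ZrUnity.ofHistoryBlind` over K0a FILE 17 `finsum_ζ0_ZrOfRecord₁₃`; `hP : (…).Provisos₁₃SepCoPH F N` at the door — the K0⁷ skeleton's own product — is the ONLY K0-side hypothesis left.) (= `N24_stabilityBR13SepCoPH_thetaShape20_rebindX_fourPin_pointed_theta13OfThm1CCM_door` with `hP := §0`; signs `0 ≤ B₃` from the floor, `0 ≤ B₃'` from `0 ≤ b9Of·B₃ ≤ B₃'` (`b9Of_pos`); the WORLD's β-box letters `hlo ∕ hhi` (at `w.b`, `w.βup`, `w.γ ≤ ½`; present in the consequent ∕ rung-2 forms only) stay the closer's — at `w.γ = ½`, `w.b = b`, `w.βup = β'` they ARE the K0 box `hbox ∕ hbox'`.) -/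
theorem N24_stabilityBR13SepCoPH_thetaShape20_rebindX_fourPin_pointed_theta13OfThm1CCM_cube_of_prop8TopStep_of_prop6Member_of_betaBox_door (hm : 4 ≤ F.m) {B₃ a₀ a₁ B₁ c₁ B₃' a₁' : ℝ} (hB₃ : 2 * (F.L : ℝ) ^ 2 ≤ B₃) (ha₀ : 0 < a₀)
    (h8 : Prop8RegSepTopStepGB F 2 (fun ν K Ω => suppDomOfRecord F ν K Ω) (floorGuard F ((11 * 4 + 3 * F.L) * F.L)) (lamDatum F) (dataSmall7PTopOf F 2) B₃ a₀ a₁) (hB₁ : 0 ≤ B₁) (hc₁ : 0 < c₁)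
    (hP6 : letI : CStarAlgebra (MatA 2) := {}; B8.Prop6Printed 4 (F.L : ℝ) B₁ c₁ (fun i : B8LeafModelZd.ZdIdx 4 F.L => zdCub (MatA 2) F.L i))
    (hB₉ : b9Of F (F.L ^ 3) B₁ * B₃ ≤ B₃') (ha₁' : 0 < a₁') (ha₁'le : a₁' ≤ min a₁ (a0Of F 2 (F.L ^ 3) B₁ c₁ / B₃))
    {ε₀ ε₂₉ : ℝ} (hε : 0 < ε₀) (hε' : 0 < ε₂₉) {b β' : ℝ} (hb : 0 ≤ b) (hbox : BetaLowerH b (1 / 2) (betaOfRecord₁₃ F 2 (theta13OfThm1CCM F 2 3 ε₀ ε₂₉ B₃ B₃' a₀ a₁')))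
    (hbox' : BetaUpperH β' (1 / 2) (betaOfRecord₁₃ F 2 (theta13OfThm1CCM F 2 3 ε₀ ε₂₉ B₃ B₃' a₀ a₁'))) (hβ' : β' ≤ 3)
    (X' : B12.RunParams → PrintedCarriersR)
    (Mstar : ℕ)
    (ops : OpsY 2 (theta13OfThm1CCM F 2 3 ε₀ ε₂₉ B₃ B₃' a₀ a₁').toStage3Params Mstar)
    (ζ : ResidZ F 2)
    (lamW : ResidW F 2)
    (w : WorldP)
    (hC : w.C = (datumOfRecord₁₃SepCoPH F 2 (Stage13HParams.ofHistoryBlind F 2 ⟨theta13OfThm1CCM F 2 3 ε₀ ε₂₉ B₃ B₃' a₀ a₁', ZrOfRecord₁₃ F 2 (theta13OfThm1CCM F 2 3 ε₀ ε₂₉ B₃ B₃' a₀ a₁')⟩) (N24_provisos₁₃SepCoPH_door_theta13OfThm1CCM_cube_of_prop8TopStep_of_prop6Member_of_betaBox F hm hB₃ ha₀ h8 hB₁ hc₁ hP6 hB₉ ha₁' ha₁'le hε hε' hb hbox hbox' hβ')).C)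
    (hγ : 0 < w.γ ∧ w.γ ≤ (theta13OfThm1CCM F 2 3 ε₀ ε₂₉ B₃ B₃' a₀ a₁').γ)
    (hL : w.L = ((theta13OfThm1CCM F 2 3 ε₀ ε₂₉ B₃ B₃' a₀ a₁').L : ℝ))
    (hup : ∀ P, w.up P = upOfRecord₅C F 2 (((Stage13HParams.ofHistoryBlind F 2 ⟨theta13OfThm1CCM F 2 3 ε₀ ε₂₉ B₃ B₃' a₀ a₁', ZrOfRecord₁₃ F 2 (theta13OfThm1CCM F 2 3 ε₀ ε₂₉ B₃ B₃' a₀ a₁')⟩).rebindX F 2 X').view₁₃CoPHB10YZW F 2 Mstar ops ζ lamW) P)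
    (h05 : ∀ P : B12.RunParams,
      B8LeafR (X' P).d8 (X' P).L8 (X' P).C₂ (X' P).B₁' (X' P).B₀' (X' P).B₁ (X' P).B₂ (X' P).c₁
        (X' P).inp8 (X' P).B₀β (X' P).loc8 (X' P).fam8R (X' P).lan8 (X' P).cub8 (X' P).toAxial8)
    (h06 : B9LeafX (Y9OfRecord 2 (theta13OfThm1CCM F 2 3 ε₀ ε₂₉ B₃ B₃' a₀ a₁').toStage3Params Mstar ops))
    (h07 : B11Leaf (Z11OfRecord F 2 ζ))
    (h08 : PrintedUV3V 2 (theta13OfThm1CCM F 2 3 ε₀ ε₂₉ B₃ B₃' a₀ a₁').L)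
    (h09 : ∀ P : B12.RunParams, B12Sec2to5.Lemma4Printed (X' P).F12 (X' P).c12)
    (h09T : ∀ P : B12.RunParams, (leavesP w P).smallCouplings → (leavesP w P).smallFieldInductive)
    (h10 : ∀ P : B12.RunParams, B9LeafX (Y9OfRecord 2 (theta13OfThm1CCM F 2 3 ε₀ ε₂₉ B₃ B₃' a₀ a₁').toStage3Params Mstar ops) →
      (B10.Thm1PrintedCompact ((((Stage13HParams.ofHistoryBlind F 2 ⟨theta13OfThm1CCM F 2 3 ε₀ ε₂₉ B₃ B₃' a₀ a₁', ZrOfRecord₁₃ F 2 (theta13OfThm1CCM F 2 3 ε₀ ε₂₉ B₃ B₃' a₀ a₁')⟩).rebindX F 2 X').view₁₃CoPHB10YZW F 2 Mstar ops ζ lamW).res.X P).runs10 ∧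
          B10.Thm2Printed ((((Stage13HParams.ofHistoryBlind F 2 ⟨theta13OfThm1CCM F 2 3 ε₀ ε₂₉ B₃ B₃' a₀ a₁', ZrOfRecord₁₃ F 2 (theta13OfThm1CCM F 2 3 ε₀ ε₂₉ B₃ B₃' a₀ a₁')⟩).rebindX F 2 X').view₁₃CoPHB10YZW F 2 Mstar ops ζ lamW).res.X P).runs10) →
        B11Leaf (Z11OfRecord F 2 ζ) → B12Sec2to5.Lemma4Printed (X' P).F12 (X' P).c12 →
          B13.Lemma1Printed (X' P).S13 (X' P).c13 ∧ B13.Lemma2Printed (X' P).S13 (X' P).c13 ∧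
            B13.Lemma3Printed (X' P).S13 (X' P).c13)
    (h11 : ∀ P : B12.RunParams, (leavesP w P).b7 → (leavesP w P).b8 → (leavesP w P).b9 → (leavesP w P).b10 → (leavesP w P).b11 →
      (leavesP w P).smallCouplings → (leavesP w P).smallFieldInductive → (leavesP w P).flowControl →
        ∀ k, k < P.K → SLaw₁₃CoPH F 2 (Stage13HParams.ofHistoryBlind F 2 ⟨theta13OfThm1CCM F 2 3 ε₀ ε₂₉ B₃ B₃' a₀ a₁', ZrOfRecord₁₃ F 2 (theta13OfThm1CCM F 2 3 ε₀ ε₂₉ B₃ B₃' a₀ a₁')⟩) P k → TLaw₁₃CoPH F 2 (Stage13HParams.ofHistoryBlind F 2 ⟨theta13OfThm1CCM F 2 3 ε₀ ε₂₉ B₃ B₃' a₀ a₁', ZrOfRecord₁₃ F 2 (theta13OfThm1CCM F 2 3 ε₀ ε₂₉ B₃ B₃' a₀ a₁')⟩) P k)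
    (h12 : ∀ P : B12.RunParams, B15Leaf (WOfRecord₁₃ F 2 (theta13OfThm1CCM F 2 3 ε₀ ε₂₉ B₃ B₃' a₀ a₁') lamW P))
    (hUV : ∀ P : B12.RunParams, (genFlow (betaOfRecord₁₃ F 2 (theta13OfThm1CCM F 2 3 ε₀ ε₂₉ B₃ B₃' a₀ a₁')) P.g0).InInterval w.γ P.K → ∀ k, k ≤ P.K → SLaw₁₃CoPH F 2 (Stage13HParams.ofHistoryBlind F 2 ⟨theta13OfThm1CCM F 2 3 ε₀ ε₂₉ B₃ B₃' a₀ a₁', ZrOfRecord₁₃ F 2 (theta13OfThm1CCM F 2 3 ε₀ ε₂₉ B₃ B₃' a₀ a₁')⟩) P k →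
      ∀ U : GaugeField (F.P P.K) k (SU 2),
        chiβOfRecord₁₃ F 2 (theta13OfThm1CCM F 2 3 ε₀ ε₂₉ B₃ B₃' a₀ a₁') P.K (gOfRecord₁₃ F 2 (theta13OfThm1CCM F 2 3 ε₀ ε₂₉ B₃ B₃' a₀ a₁') P) k U *
              Real.exp (-(1 / (gOfRecord₁₃ F 2 (theta13OfThm1CCM F 2 3 ε₀ ε₂₉ B₃ B₃' a₀ a₁') P k) ^ 2 * wilsonBGOfRecord F 2 (theta13OfThm1CCM F 2 3 ε₀ ε₂₉ B₃ B₃' a₀ a₁').εbg P k U)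
                - w.em (gOfRecord₁₃ F 2 (theta13OfThm1CCM F 2 3 ε₀ ε₂₉ B₃ B₃' a₀ a₁') P k) * (Fintype.card (Site (F.P P.K) k) : ℝ)) ≤ densOfRecord₁₃ F 2 (theta13OfThm1CCM F 2 3 ε₀ ε₂₉ B₃ B₃' a₀ a₁') P k U ∧
        densOfRecord₁₃ F 2 (theta13OfThm1CCM F 2 3 ε₀ ε₂₉ B₃ B₃' a₀ a₁') P k U ≤ Real.exp (w.ep (gOfRecord₁₃ F 2 (theta13OfThm1CCM F 2 3 ε₀ ε₂₉ B₃ B₃' a₀ a₁') P k) * (Fintype.card (Site (F.P P.K) k) : ℝ)))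
    (hlo : BetaLowerH w.b w.γ (betaOfRecord₁₃ F 2 (theta13OfThm1CCM F 2 3 ε₀ ε₂₉ B₃ B₃' a₀ a₁')))
    (hhi : BetaUpperH w.βup w.γ (betaOfRecord₁₃ F 2 (theta13OfThm1CCM F 2 3 ε₀ ε₂₉ B₃ B₃' a₀ a₁'))) :
    ∃ (θ' : Stage13HParams F 2) (h' : θ'.Provisos₁₃SepCoPH F 2), (θ'.ZhUnity F 2 ∧ θ'.SlotsNondegenerate₁₃ F 2) ∧ θ'.Admissible F 2 ∧
      B16.EndStatementBPrinted (datumOfRecord₁₃SepCoPH F 2 θ' h').C ∧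
      ∃ γ₁ : ℝ, 0 < γ₁ ∧ ∀ γ : ℝ, 0 < γ → γ ≤ γ₁ → ∃ P : B12.RunParams, 1 ≤ P.K ∧ ((datumOfRecord₁₃SepCoPH F 2 θ' h').C P).flow.InInterval γ P.K := by
  have hL0 : (0 : ℝ) < (F.L : ℝ) := by exact_mod_cast lt_trans Nat.zero_lt_one F.hL.2
  have hBpos : (0 : ℝ) < B₃ := lt_of_lt_of_le (mul_pos two_pos (pow_pos hL0 2)) hB₃
  have hB9 : (0 : ℝ) ≤ B₃' := (mul_nonneg (b9Of_pos (F := F) (F.L ^ 3) hB₁).le hBpos.le).trans hB₉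
  exact N24_stabilityBR13SepCoPH_thetaShape20_rebindX_fourPin_pointed_theta13OfThm1CCM_door (F := F) (N := 2) hε hε' hBpos.le hB9 ha₀ ha₁' (N24_provisos₁₃SepCoPH_door_theta13OfThm1CCM_cube_of_prop8TopStep_of_prop6Member_of_betaBox F hm hB₃ ha₀ h8 hB₁ hc₁ hP6 hB₉ ha₁' ha₁'le hε hε' hb hbox hbox' hβ') X' Mstar ops ζ lamW w hC hγ hL hup h05 h06 h07 h08 h09 h09T h10 h11 h12 hUV hlo hhi

/-- **AT THE V15 WITNESS ON PRINT's RANGE `4 ≤ F.m`, `N = 2`, `j = 3`, WITH `hP` DISCHARGED MODULO EXACTLY plan g76's V15 STUB BODIES** — [15] Prop. 8's top step `Prop8RegSepTopStepGB F 2 suppDom (floorGuard F ((11·4+3·L)·L)) (lamDatum F) (dataSmall7PTopOf F 2) B₃ a₀ a₁` with `2L² ≤ B₃`, `0 < a₀`, `0 < a₁` (stub 1 `Prop8StepCoPAt F` opened), [6] Prop. 6 at NODE 00's member `B8.Prop6Printed 4 L B₁ c₁ (zdCub (MatA 2) L ·)` with `0 ≤ B₁`, `0 < c₁` (stub 2 `Prop6MemberB8At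 F` opened), the thresholds `0 < ε₀`, `0 < ε₂₉` and the β-box at the cube witness `θ₁₅ᶜᶜᴹ(3; ε₀, ε₂₉; B₃, B₃', a₀, a₁')` for ANY gauge constant `B₃' ≥ b9Of·B₃` and ceiling `0 < a₁' ≤ min a₁ (a0Of∕B₃)` (V15's exact letters `B₃' := b9Of F L³ B₁ · B₃`, `a₁' := min a₁ (a0Of F 2 L³ B₁ c₁ ∕ B₃)` with `le_rfl`; stub 3′ `BetaBoxAtThm1WitnessCCMAt F`'s ∃-body opened) and `hm : 4 ≤ F.m` ((δ)); door provisos BY NAME (§0) through dag-n07-e's bridge `variationalThm1RegSepCoP7MGB_of_prop8TopStepGB_lamDatum`, dag-n21-c FILE C's `gauge9R_cube_of_prop8TopStep_of_prop6Member` and B′'s monotonicity `VariationalThm1GaugeRegSepCoP7MGB.mono ∕ .of_le` — AT THE V15 WITNESS `Stage13HParams.ofHistoryBlind ⟨θ₁₅ᶜᶜᴹ, ZrOfRecord₁₃ θ₁₅ᶜᶜᴹ⟩` (the history-blind door over the cured residual of the collared `θ₁₅ᶜᶜᴹ(j) = theta13OfThm1CCM F N j ε₀ ε₂₉ B₃ B₃'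 a₀ a₁`; `= ofHistoryBlind (Stage13RParams.ofCured θ₁₅ᶜᶜᴹ)`, `rfl`) — THE ∃-BODY OF `BetaWindowAtSomeRecord13` OVER THE X-REBOUND FOUR-PIN VIEW**, witnesses `(θ, hP, w)` (guard `hU` displayed).
[cite: Balaban1989LargeFieldII, Thm 1 p.355, (0.1) pp.355–356, p.391; Balaban1987RG1, Thm 3 p.264, (0.17)–(0.20) pp.255–256 and (1.22) p.264, (2.9) p.266; Balaban1985UV3, Thm 1 p.257 (bookkeeping + elementary window)] (= `N24_betaWindowAtSomeRecord₁₃SepCoPH_of_rebindX_fourPin_pointed_of_boxH` at `θ := the door`; `Admissible` ← dag-n21-c `admissible_theta13OfThm1CCM` (six signs), `SlotsNondegenerate₁₃` ← dag-n21-c `slotsNondegenerate₁₃_theta13OfThm1CCM` (hypothesis-free), N13's (R₁₃) ← §0 `N24_laws₁₃CoPH_theta13OfThm1CCM` (= dag-n11-e's generic `rOpLeaf_VOfRecord₁₃CoPH_theta13LiveOfNumerics` at the member, six signs) — ALL BY NAME; the β-box pair `hlo ∕ hhi` read at the witness's β of record `betaOfRecord₁₃ F N θ₁₅ᶜᶜᴹ`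 (def-T `βfun_datumOfRecord₁₃SepCoPH`, `rfl`) = the currency of V15's stub 3′ `stub_betaBoxAtThm1WitnessCCM13` (there at `j = 3`, γ = 1∕2 = `θ₁₅ᶜᶜᴹ.γ`); the unity guard DISCHARGED by `Stage13RParams.ZrUnity.ofHistoryBlind` over K0a FILE 17 `finsum_ζ0_ZrOfRecord₁₃`; `hP : (…).Provisos₁₃SepCoPH F N` at the door — the K0⁷ skeleton's own product — is the ONLY K0-side hypothesis left.) (= `N24_betaWindowAtSomeRecord₁₃SepCoPH_of_rebindX_fourPin_pointed_of_boxH_theta13OfThm1CCM_door` with `hP := §0`; signs `0 ≤ B₃` from the floor, `0 ≤ B₃'` from `0 ≤ b9Of·B₃ ≤ B₃'` (`b9Of_pos`); the WORLD's β-box letters `hlo ∕ hhi` (at `w.b`, `w.βup`, `w.γ ≤ ½`; present in the consequent ∕ rung-2 forms only) stay the closer's — at `w.γ = ½`, `w.b = b`, `w.βup = β'` they ARE the K0 box `hbox ∕ hbox'`.) -/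
theorem N24_betaWindowAtSomeRecord₁₃SepCoPH_of_rebindX_fourPin_pointed_of_boxH_theta13OfThm1CCM_cube_of_prop8TopStep_of_prop6Member_of_betaBox_door (hm : 4 ≤ F.m) {B₃ a₀ a₁ B₁ c₁ B₃' a₁' : ℝ} (hB₃ : 2 * (F.L : ℝ) ^ 2 ≤ B₃) (ha₀ : 0 < a₀)
    (h8 : Prop8RegSepTopStepGB F 2 (fun ν K Ω => suppDomOfRecord F ν K Ω) (floorGuard F ((11 * 4 + 3 * F.L) * F.L)) (lamDatum F) (dataSmall7PTopOf F 2) B₃ a₀ a₁) (hB₁ : 0 ≤ B₁) (hc₁ : 0 < c₁)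
    (hP6 : letI : CStarAlgebra (MatA 2) := {}; B8.Prop6Printed 4 (F.L : ℝ) B₁ c₁ (fun i : B8LeafModelZd.ZdIdx 4 F.L => zdCub (MatA 2) F.L i))
    (hB₉ : b9Of F (F.L ^ 3) B₁ * B₃ ≤ B₃') (ha₁' : 0 < a₁') (ha₁'le : a₁' ≤ min a₁ (a0Of F 2 (F.L ^ 3) B₁ c₁ / B₃))
    {ε₀ ε₂₉ : ℝ} (hε : 0 < ε₀) (hε' : 0 < ε₂₉) {b β' : ℝ} (hb : 0 ≤ b) (hbox : BetaLowerH b (1 / 2) (betaOfRecord₁₃ F 2 (theta13OfThm1CCM F 2 3 ε₀ ε₂₉ B₃ B₃' a₀ a₁')))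
    (hbox' : BetaUpperH β' (1 / 2) (betaOfRecord₁₃ F 2 (theta13OfThm1CCM F 2 3 ε₀ ε₂₉ B₃ B₃' a₀ a₁'))) (hβ' : β' ≤ 3)
    (X' : B12.RunParams → PrintedCarriersR)
    (Mstar : ℕ)
    (ops : OpsY 2 (theta13OfThm1CCM F 2 3 ε₀ ε₂₉ B₃ B₃' a₀ a₁').toStage3Params Mstar)
    (ζ : ResidZ F 2)
    (lamW : ResidW F 2)
    (w : WorldP)
    (hC : w.C = (datumOfRecord₁₃SepCoPH F 2 (Stage13HParams.ofHistoryBlind F 2 ⟨theta13OfThm1CCM F 2 3 ε₀ ε₂₉ B₃ B₃' a₀ a₁', ZrOfRecord₁₃ F 2 (theta13OfThm1CCM F 2 3 ε₀ ε₂₉ B₃ B₃' a₀ a₁')⟩) (N24_provisos₁₃SepCoPH_door_theta13OfThm1CCM_cube_of_prop8TopStep_of_prop6Member_of_betaBox F hm hB₃ ha₀ h8 hB₁ hc₁ hP6 hB₉ ha₁' ha₁'le hε hε' hb hbox hbox' hβ')).C)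
    (hγ : 0 < w.γ ∧ w.γ ≤ (theta13OfThm1CCM F 2 3 ε₀ ε₂₉ B₃ B₃' a₀ a₁').γ)
    (hL : w.L = ((theta13OfThm1CCM F 2 3 ε₀ ε₂₉ B₃ B₃' a₀ a₁').L : ℝ))
    (hup : ∀ P, w.up P = upOfRecord₅C F 2 (((Stage13HParams.ofHistoryBlind F 2 ⟨theta13OfThm1CCM F 2 3 ε₀ ε₂₉ B₃ B₃' a₀ a₁', ZrOfRecord₁₃ F 2 (theta13OfThm1CCM F 2 3 ε₀ ε₂₉ B₃ B₃' a₀ a₁')⟩).rebindX F 2 X').view₁₃CoPHB10YZW F 2 Mstar ops ζ lamW) P)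
    (h05 : ∀ P : B12.RunParams,
      B8LeafR (X' P).d8 (X' P).L8 (X' P).C₂ (X' P).B₁' (X' P).B₀' (X' P).B₁ (X' P).B₂ (X' P).c₁
        (X' P).inp8 (X' P).B₀β (X' P).loc8 (X' P).fam8R (X' P).lan8 (X' P).cub8 (X' P).toAxial8)
    (h06 : B9LeafX (Y9OfRecord 2 (theta13OfThm1CCM F 2 3 ε₀ ε₂₉ B₃ B₃' a₀ a₁').toStage3Params Mstar ops))
    (h07 : B11Leaf (Z11OfRecord F 2 ζ))
    (h08 : PrintedUV3V 2 (theta13OfThm1CCM F 2 3 ε₀ ε₂₉ B₃ B₃' a₀ a₁').L)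
    (h09 : ∀ P : B12.RunParams, B12Sec2to5.Lemma4Printed (X' P).F12 (X' P).c12)
    (h09T : ∀ P : B12.RunParams, (leavesP w P).smallCouplings → (leavesP w P).smallFieldInductive)
    (h10 : ∀ P : B12.RunParams, B9LeafX (Y9OfRecord 2 (theta13OfThm1CCM F 2 3 ε₀ ε₂₉ B₃ B₃' a₀ a₁').toStage3Params Mstar ops) →
      (B10.Thm1PrintedCompact ((((Stage13HParams.ofHistoryBlind F 2 ⟨theta13OfThm1CCM F 2 3 ε₀ ε₂₉ B₃ B₃' a₀ a₁', ZrOfRecord₁₃ F 2 (theta13OfThm1CCM F 2 3 ε₀ ε₂₉ B₃ B₃' a₀ a₁')⟩).rebindX F 2 X').view₁₃CoPHB10YZW F 2 Mstar ops ζ lamW).res.X P).runs10 ∧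
          B10.Thm2Printed ((((Stage13HParams.ofHistoryBlind F 2 ⟨theta13OfThm1CCM F 2 3 ε₀ ε₂₉ B₃ B₃' a₀ a₁', ZrOfRecord₁₃ F 2 (theta13OfThm1CCM F 2 3 ε₀ ε₂₉ B₃ B₃' a₀ a₁')⟩).rebindX F 2 X').view₁₃CoPHB10YZW F 2 Mstar ops ζ lamW).res.X P).runs10) →
        B11Leaf (Z11OfRecord F 2 ζ) → B12Sec2to5.Lemma4Printed (X' P).F12 (X' P).c12 →
          B13.Lemma1Printed (X' P).S13 (X' P).c13 ∧ B13.Lemma2Printed (X' P).S13 (X' P).c13 ∧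
            B13.Lemma3Printed (X' P).S13 (X' P).c13)
    (h11 : ∀ P : B12.RunParams, (leavesP w P).b7 → (leavesP w P).b8 → (leavesP w P).b9 → (leavesP w P).b10 → (leavesP w P).b11 →
      (leavesP w P).smallCouplings → (leavesP w P).smallFieldInductive → (leavesP w P).flowControl →
        ∀ k, k < P.K → SLaw₁₃CoPH F 2 (Stage13HParams.ofHistoryBlind F 2 ⟨theta13OfThm1CCM F 2 3 ε₀ ε₂₉ B₃ B₃' a₀ a₁', ZrOfRecord₁₃ F 2 (theta13OfThm1CCM F 2 3 ε₀ ε₂₉ B₃ B₃' a₀ a₁')⟩) P k → TLaw₁₃CoPH F 2 (Stage13HParams.ofHistoryBlind F 2 ⟨theta13OfThm1CCM F 2 3 ε₀ ε₂₉ B₃ B₃' a₀ a₁', ZrOfRecord₁₃ F 2 (theta13OfThm1CCM F 2 3 ε₀ ε₂₉ B₃ B₃' a₀ a₁')⟩) P k)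
    (h12 : ∀ P : B12.RunParams, B15Leaf (WOfRecord₁₃ F 2 (theta13OfThm1CCM F 2 3 ε₀ ε₂₉ B₃ B₃' a₀ a₁') lamW P))
    (hUV : ∀ P : B12.RunParams, (genFlow (betaOfRecord₁₃ F 2 (theta13OfThm1CCM F 2 3 ε₀ ε₂₉ B₃ B₃' a₀ a₁')) P.g0).InInterval w.γ P.K → ∀ k, k ≤ P.K → SLaw₁₃CoPH F 2 (Stage13HParams.ofHistoryBlind F 2 ⟨theta13OfThm1CCM F 2 3 ε₀ ε₂₉ B₃ B₃' a₀ a₁', ZrOfRecord₁₃ F 2 (theta13OfThm1CCM F 2 3 ε₀ ε₂₉ B₃ B₃' a₀ a₁')⟩) P k →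
      ∀ U : GaugeField (F.P P.K) k (SU 2),
        chiβOfRecord₁₃ F 2 (theta13OfThm1CCM F 2 3 ε₀ ε₂₉ B₃ B₃' a₀ a₁') P.K (gOfRecord₁₃ F 2 (theta13OfThm1CCM F 2 3 ε₀ ε₂₉ B₃ B₃' a₀ a₁') P) k U *
              Real.exp (-(1 / (gOfRecord₁₃ F 2 (theta13OfThm1CCM F 2 3 ε₀ ε₂₉ B₃ B₃' a₀ a₁') P k) ^ 2 * wilsonBGOfRecord F 2 (theta13OfThm1CCM F 2 3 ε₀ ε₂₉ B₃ B₃' a₀ a₁').εbg P k U)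
                - w.em (gOfRecord₁₃ F 2 (theta13OfThm1CCM F 2 3 ε₀ ε₂₉ B₃ B₃' a₀ a₁') P k) * (Fintype.card (Site (F.P P.K) k) : ℝ)) ≤ densOfRecord₁₃ F 2 (theta13OfThm1CCM F 2 3 ε₀ ε₂₉ B₃ B₃' a₀ a₁') P k U ∧
        densOfRecord₁₃ F 2 (theta13OfThm1CCM F 2 3 ε₀ ε₂₉ B₃ B₃' a₀ a₁') P k U ≤ Real.exp (w.ep (gOfRecord₁₃ F 2 (theta13OfThm1CCM F 2 3 ε₀ ε₂₉ B₃ B₃' a₀ a₁') P k) * (Fintype.card (Site (F.P P.K) k) : ℝ)))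
    (hlo : BetaLowerH w.b w.γ (betaOfRecord₁₃ F 2 (theta13OfThm1CCM F 2 3 ε₀ ε₂₉ B₃ B₃' a₀ a₁')))
    (hhi : BetaUpperH w.βup w.γ (betaOfRecord₁₃ F 2 (theta13OfThm1CCM F 2 3 ε₀ ε₂₉ B₃ B₃' a₀ a₁'))) :
    ∃ (θ' : Stage13HParams F 2) (h' : θ'.Provisos₁₃SepCoPH F 2) (w' : WorldP), (θ'.ZhUnity F 2 ∧ θ'.SlotsNondegenerate₁₃ F 2) ∧ θ'.Admissible F 2 ∧
      IsRecordOfRecord₁₃CSepCoPH F 2 (datumOfRecord₁₃SepCoPH F 2 θ' h') w' ∧ (∀ P : B12.RunParams, Nodes (leavesP w' P)) ∧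
      BetaBoundsInInterval w'.C.toB12 w'.γ w'.b w'.βup ∧
      ∃ γ₁ : ℝ, 0 < γ₁ ∧ ∀ γ : ℝ, 0 < γ → γ ≤ γ₁ → ∃ P : B12.RunParams, 1 ≤ P.K ∧ ((datumOfRecord₁₃SepCoPH F 2 θ' h').C P).flow.InInterval γ P.K := by
  have hL0 : (0 : ℝ) < (F.L : ℝ) := by exact_mod_cast lt_trans Nat.zero_lt_one F.hL.2
  have hBpos : (0 : ℝ) < B₃ := lt_of_lt_of_le (mul_pos two_pos (pow_pos hL0 2)) hB₃
  have hB9 : (0 : ℝ) ≤ B₃' := (mul_nonneg (b9Of_pos (F := F) (F.L ^ 3) hB₁).le hBpos.le).trans hB₉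
  exact N24_betaWindowAtSomeRecord₁₃SepCoPH_of_rebindX_fourPin_pointed_of_boxH_theta13OfThm1CCM_door (F := F) (N := 2) hε hε' hBpos.le hB9 ha₀ ha₁' (N24_provisos₁₃SepCoPH_door_theta13OfThm1CCM_cube_of_prop8TopStep_of_prop6Member_of_betaBox F hm hB₃ ha₀ h8 hB₁ hc₁ hP6 hB₉ ha₁' ha₁'le hε hε' hb hbox hbox' hβ') X' Mstar ops ζ lamW w hC hγ hL hup h05 h06 h07 h08 h09 h09T h10 h11 h12 hUV hlo hhi

/-- **AT THE V15 WITNESS ON PRINT's RANGE `4 ≤ F.m`, `N = 2`, `j = 3`, WITH `hP` DISCHARGED MODULO EXACTLY plan g76's V15 STUB BODIES** — [15] Prop. 8's top step `Prop8RegSepTopStepGB F 2 suppDom (floorGuard F ((11·4+3·L)·L)) (lamDatum F) (dataSmall7PTopOf F 2) B₃ a₀ a₁` with `2L² ≤ B₃`, `0 < a₀`, `0 < a₁` (stub 1 `Prop8StepCoPAt F` opened), [6] Prop. 6 at NODE 00's member `B8.Prop6Printed 4 L B₁ c₁ (zdCub (MatA 2) L ·)` with `0 ≤ B₁`, `0 <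 c₁` (stub 2 `Prop6MemberB8At F` opened), the thresholds `0 < ε₀`, `0 < ε₂₉` and the β-box at the cube witness `θ₁₅ᶜᶜᴹ(3; ε₀, ε₂₉; B₃, B₃', a₀, a₁')` for ANY gauge constant `B₃' ≥ b9Of·B₃` and ceiling `0 < a₁' ≤ min a₁ (a0Of∕B₃)` (V15's exact letters `B₃' := b9Of F L³ B₁ · B₃`, `a₁' := min a₁ (a0Of F 2 L³ B₁ c₁ ∕ B₃)` with `le_rfl`; stub 3′ `BetaBoxAtThm1WitnessCCMAt F`'s ∃-body opened) and `hm : 4 ≤ F.m` ((δ)); door provisos BY NAME (§0) through dag-n07-e's bridge `variationalThm1RegSepCoP7MGB_of_prop8TopStepGB_lamDatum`, dag-n21-c FILE C's `gauge9R_cube_of_prop8TopStep_of_prop6Member` and B′'s monotonicity `VariationalThm1GaugeRegSepCoP7MGB.mono ∕ .of_le` — AT THE V15 WITNESS `Stage13HParams.ofHistoryBlind ⟨θ₁₅ᶜᶜᴹ, ZrOfRecord₁₃ θ₁₅ᶜᶜᴹ⟩` (the history-blind door over the cured residual of the collared `θ₁₅ᶜᶜᴹ(j) = theta13OfThm1CCM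 F N j ε₀ ε₂₉ B₃ B₃' a₀ a₁`; `= ofHistoryBlind (Stage13RParams.ofCured θ₁₅ᶜᶜᴹ)`, `rfl`) — ★ ITEM K1⁷ (stmt-QuantumFields-20542)'s θ-KEYED CONSEQUENT, WITNESSED BY `(θ, hP)`, FROM THE POINTED CHILDREN ON N05's SURVIVING ROUTE** — the world S-bound to the four-pin
view of the H-pinned parameter, N05 ← the repaired surviving slot; (B) by the previous theorem at `hP.toCore` (datum bridge `rfl`), window by module 26.
COMPOSITE: nothing is discharged. [cite: Balaban1989LargeFieldII, Thm 1 p.355, (0.1) pp.355–356, p.391; Balaban1985RegularSpaces, Thm 8 (1.146) p.101; Balaban1987RG1, Thm 3 p.264, (0.17)–(0.20) pp.255–256 and (1.22) p.264; Balaban1985UV3, Thm 1 p.257 (bookkeeping + elementary window)] (= `N24_stabilityBR13SepCoPH_thetaShape20_pinX3HS_fourPin_pointed` at `θ := the door`; `Admissible` ← dag-n21-c `admissible_theta13OfThm1CCM` (six signs), `SlotsNondegenerate₁₃` ← dag-n21-c `slotsNondegenerate₁₃_theta13OfThm1CCM` (hypothesis-free), N13's (R₁₃) ← §0 `N24_laws₁₃CoPH_theta13OfThm1CCM`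 (= dag-n11-e's generic `rOpLeaf_VOfRecord₁₃CoPH_theta13LiveOfNumerics` at the member, six signs) — ALL BY NAME; the β-box pair `hlo ∕ hhi` read at the witness's β of record `betaOfRecord₁₃ F N θ₁₅ᶜᶜᴹ` (def-T `βfun_datumOfRecord₁₃SepCoPH`, `rfl`) = the currency of V15's stub 3′ `stub_betaBoxAtThm1WitnessCCM13` (there at `j = 3`, γ = 1∕2 = `θ₁₅ᶜᶜᴹ.γ`); the unity guard DISCHARGED by `Stage13RParams.ZrUnity.ofHistoryBlind` over K0a FILE 17 `finsum_ζ0_ZrOfRecord₁₃`; `hP : (…).Provisos₁₃SepCoPH F N` at the door — the K0⁷ skeleton's own product — is the ONLY K0-side hypothesis left.) (= `N24_stabilityBR13SepCoPH_thetaShape20_pinX3HS_fourPin_pointed_theta13OfThm1CCM_door` with `hP := §0`; signs `0 ≤ B₃` from the floor, `0 ≤ B₃'` from `0 ≤ b9Of·B₃ ≤ B₃'` (`b9Of_pos`); the WORLD's β-box letters `hlo ∕ hhi` (at `w.b`, `w.βup`, `w.γ ≤ ½`; present in the consequent ∕ rung-2 forms only) stay the closer's — at `w.γ = ½`, `w.b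 = b`, `w.βup = β'` they ARE the K0 box `hbox ∕ hbox'`.) -/
theorem N24_stabilityBR13SepCoPH_thetaShape20_pinX3HS_fourPin_pointed_theta13OfThm1CCM_cube_of_prop8TopStep_of_prop6Member_of_betaBox_door (hm : 4 ≤ F.m) {B₃ a₀ a₁ B₁ c₁ B₃' a₁' : ℝ} (hB₃ : 2 * (F.L : ℝ) ^ 2 ≤ B₃) (ha₀ : 0 < a₀)
    (h8 : Prop8RegSepTopStepGB F 2 (fun ν K Ω => suppDomOfRecord F ν K Ω) (floorGuard F ((11 * 4 + 3 * F.L) * F.L)) (lamDatum F) (dataSmall7PTopOf F 2) B₃ a₀ a₁) (hB₁ : 0 ≤ B₁) (hc₁ : 0 < c₁)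
    (hP6 : letI : CStarAlgebra (MatA 2) := {}; B8.Prop6Printed 4 (F.L : ℝ) B₁ c₁ (fun i : B8LeafModelZd.ZdIdx 4 F.L => zdCub (MatA 2) F.L i))
    (hB₉ : b9Of F (F.L ^ 3) B₁ * B₃ ≤ B₃') (ha₁' : 0 < a₁') (ha₁'le : a₁' ≤ min a₁ (a0Of F 2 (F.L ^ 3) B₁ c₁ / B₃))
    {ε₀ ε₂₉ : ℝ} (hε : 0 < ε₀) (hε' : 0 < ε₂₉) {b β' : ℝ} (hb : 0 ≤ b) (hbox : BetaLowerH b (1 / 2) (betaOfRecord₁₃ F 2 (theta13OfThm1CCM F 2 3 ε₀ ε₂₉ B₃ B₃' a₀ a₁')))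
    (hbox' : BetaUpperH β' (1 / 2) (betaOfRecord₁₃ F 2 (theta13OfThm1CCM F 2 3 ε₀ ε₂₉ B₃ B₃' a₀ a₁'))) (hβ' : β' ≤ 3)
    (lam8 : ResidB8 (theta13OfThm1CCM F 2 3 ε₀ ε₂₉ B₃ B₃' a₀ a₁').toStage3Params)
    (lam12 : ResidB12 F 2 (theta13OfThm1CCM F 2 3 ε₀ ε₂₉ B₃ B₃' a₀ a₁').τ9.M)
    (lam13 : B12.RunParams → ResidB13 (theta13OfThm1CCM F 2 3 ε₀ ε₂₉ B₃ B₃' a₀ a₁').toStage3Params)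
    (Mstar : ℕ)
    (ops : OpsY 2 (theta13OfThm1CCM F 2 3 ε₀ ε₂₉ B₃ B₃' a₀ a₁').toStage3Params Mstar)
    (ζ : ResidZ F 2)
    (lamW : ResidW F 2)
    (w : WorldP)
    (hC : w.C = (datumOfRecord₁₃SepCoPH F 2 (Stage13HParams.ofHistoryBlind F 2 ⟨theta13OfThm1CCM F 2 3 ε₀ ε₂₉ B₃ B₃' a₀ a₁', ZrOfRecord₁₃ F 2 (theta13OfThm1CCM F 2 3 ε₀ ε₂₉ B₃ B₃' a₀ a₁')⟩) (N24_provisos₁₃SepCoPH_door_theta13OfThm1CCM_cube_of_prop8TopStep_of_prop6Member_of_betaBox F hm hB₃ ha₀ h8 hB₁ hc₁ hP6 hB₉ ha₁' ha₁'le hε hε' hb hbox hbox' hβ')).C)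
    (hγ : 0 < w.γ ∧ w.γ ≤ (theta13OfThm1CCM F 2 3 ε₀ ε₂₉ B₃ B₃' a₀ a₁').γ)
    (hL : w.L = ((theta13OfThm1CCM F 2 3 ε₀ ε₂₉ B₃ B₃' a₀ a₁').L : ℝ))
    (hup : ∀ P, w.up P = upOfRecord₅CS F 2 (((Stage13HParams.ofHistoryBlind F 2 ⟨theta13OfThm1CCM F 2 3 ε₀ ε₂₉ B₃ B₃' a₀ a₁', ZrOfRecord₁₃ F 2 (theta13OfThm1CCM F 2 3 ε₀ ε₂₉ B₃ B₃' a₀ a₁')⟩).pinX3H F 2 lam8 lam12 lam13).view₁₃CoPHB10YZW F 2 Mstar ops ζ lamW) P)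
    (h05 : B8LeafOfRecordSubBH (theta13OfThm1CCM F 2 3 ε₀ ε₂₉ B₃ B₃' a₀ a₁').toStage3Params lam8)
    (h06 : B9LeafX (Y9OfRecord 2 (theta13OfThm1CCM F 2 3 ε₀ ε₂₉ B₃ B₃' a₀ a₁').toStage3Params Mstar ops))
    (h07 : B11Leaf (Z11OfRecord F 2 ζ))
    (h08 : PrintedUV3V 2 (theta13OfThm1CCM F 2 3 ε₀ ε₂₉ B₃ B₃' a₀ a₁').L)
    (h09 : ∀ P : B12.RunParams, B12Sec2to5.Lemma4Printed (F12OfRecord₁₂ F 2 (theta13OfThm1CCM F 2 3 ε₀ ε₂₉ B₃ B₃' a₀ a₁').toStage12Params lam12 P) (lam12 P).consts)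
    (h09T : ∀ P : B12.RunParams, (leavesP w P).smallCouplings → (leavesP w P).smallFieldInductive)
    (h10 : ∀ P : B12.RunParams, B13LeafOfRecord (theta13OfThm1CCM F 2 3 ε₀ ε₂₉ B₃ B₃' a₀ a₁').toStage3Params (lam13 P))
    (h11 : ∀ P : B12.RunParams, (leavesP w P).b7 → (leavesP w P).b8 → (leavesP w P).b9 → (leavesP w P).b10 → (leavesP w P).b11 →
      (leavesP w P).smallCouplings → (leavesP w P).smallFieldInductive → (leavesP w P).flowControl →
        ∀ k, k < P.K → SLaw₁₃CoPH F 2 (Stage13HParams.ofHistoryBlind F 2 ⟨theta13OfThm1CCM F 2 3 ε₀ ε₂₉ B₃ B₃' a₀ a₁', ZrOfRecord₁₃ F 2 (theta13OfThm1CCM F 2 3 ε₀ ε₂₉ B₃ B₃' a₀ a₁')⟩) P k → TLaw₁₃CoPH F 2 (Stage13HParams.ofHistoryBlind F 2 ⟨theta13OfThm1CCM F 2 3 ε₀ ε₂₉ B₃ B₃' a₀ a₁', ZrOfRecord₁₃ F 2 (theta13OfThm1CCM F 2 3 ε₀ ε₂₉ B₃ B₃' a₀ a₁')⟩) P k)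
    (h12 : ∀ P : B12.RunParams, B15Leaf (WOfRecord₁₃ F 2 (theta13OfThm1CCM F 2 3 ε₀ ε₂₉ B₃ B₃' a₀ a₁') lamW P))
    (hUV : ∀ P : B12.RunParams, (genFlow (betaOfRecord₁₃ F 2 (theta13OfThm1CCM F 2 3 ε₀ ε₂₉ B₃ B₃' a₀ a₁')) P.g0).InInterval w.γ P.K → ∀ k, k ≤ P.K → SLaw₁₃CoPH F 2 (Stage13HParams.ofHistoryBlind F 2 ⟨theta13OfThm1CCM F 2 3 ε₀ ε₂₉ B₃ B₃' a₀ a₁', ZrOfRecord₁₃ F 2 (theta13OfThm1CCM F 2 3 ε₀ ε₂₉ B₃ B₃' a₀ a₁')⟩) P k →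
      ∀ U : GaugeField (F.P P.K) k (SU 2),
        chiβOfRecord₁₃ F 2 (theta13OfThm1CCM F 2 3 ε₀ ε₂₉ B₃ B₃' a₀ a₁') P.K (gOfRecord₁₃ F 2 (theta13OfThm1CCM F 2 3 ε₀ ε₂₉ B₃ B₃' a₀ a₁') P) k U *
              Real.exp (-(1 / (gOfRecord₁₃ F 2 (theta13OfThm1CCM F 2 3 ε₀ ε₂₉ B₃ B₃' a₀ a₁') P k) ^ 2 * wilsonBGOfRecord F 2 (theta13OfThm1CCM F 2 3 ε₀ ε₂₉ B₃ B₃' a₀ a₁').εbg P k U)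
                - w.em (gOfRecord₁₃ F 2 (theta13OfThm1CCM F 2 3 ε₀ ε₂₉ B₃ B₃' a₀ a₁') P k) * (Fintype.card (Site (F.P P.K) k) : ℝ)) ≤ densOfRecord₁₃ F 2 (theta13OfThm1CCM F 2 3 ε₀ ε₂₉ B₃ B₃' a₀ a₁') P k U ∧
        densOfRecord₁₃ F 2 (theta13OfThm1CCM F 2 3 ε₀ ε₂₉ B₃ B₃' a₀ a₁') P k U ≤ Real.exp (w.ep (gOfRecord₁₃ F 2 (theta13OfThm1CCM F 2 3 ε₀ ε₂₉ B₃ B₃' a₀ a₁') P k) * (Fintype.card (Site (F.P P.K) k) : ℝ)))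
    (hlo : BetaLowerH w.b w.γ (betaOfRecord₁₃ F 2 (theta13OfThm1CCM F 2 3 ε₀ ε₂₉ B₃ B₃' a₀ a₁')))
    (hhi : BetaUpperH w.βup w.γ (betaOfRecord₁₃ F 2 (theta13OfThm1CCM F 2 3 ε₀ ε₂₉ B₃ B₃' a₀ a₁'))) :
    ∃ (θ' : Stage13HParams F 2) (h' : θ'.Provisos₁₃SepCoPH F 2), (θ'.ZhUnity F 2 ∧ θ'.SlotsNondegenerate₁₃ F 2) ∧ θ'.Admissible F 2 ∧
      B16.EndStatementBPrinted (datumOfRecord₁₃SepCoPH F 2 θ' h').C ∧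
      ∃ γ₁ : ℝ, 0 < γ₁ ∧ ∀ γ : ℝ, 0 < γ → γ ≤ γ₁ → ∃ P : B12.RunParams, 1 ≤ P.K ∧ ((datumOfRecord₁₃SepCoPH F 2 θ' h').C P).flow.InInterval γ P.K := by
  have hL0 : (0 : ℝ) < (F.L : ℝ) := by exact_mod_cast lt_trans Nat.zero_lt_one F.hL.2
  have hBpos : (0 : ℝ) < B₃ := lt_of_lt_of_le (mul_pos two_pos (pow_pos hL0 2)) hB₃
  have hB9 : (0 : ℝ) ≤ B₃' := (mul_nonneg (b9Of_pos (F := F) (F.L ^ 3) hB₁).le hBpos.le).trans hB₉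
  exact N24_stabilityBR13SepCoPH_thetaShape20_pinX3HS_fourPin_pointed_theta13OfThm1CCM_door (F := F) (N := 2) hε hε' hBpos.le hB9 ha₀ ha₁' (N24_provisos₁₃SepCoPH_door_theta13OfThm1CCM_cube_of_prop8TopStep_of_prop6Member_of_betaBox F hm hB₃ ha₀ h8 hB₁ hc₁ hP6 hB₉ ha₁' ha₁'le hε hε' hb hbox hbox' hβ') lam8 lam12 lam13 Mstar ops ζ lamW w hC hγ hL hup h05 h06 h07 h08 h09 h09T h10 h11 h12 hUV hlo hhi

/-- **AT THE V15 WITNESS ON PRINT's RANGE `4 ≤ F.m`, `N = 2`, `j = 3`, WITH `hP` DISCHARGED MODULO EXACTLY plan g76's V15 STUB BODIES** — [15] Prop. 8's top step `Prop8RegSepTopStepGB F 2 suppDom (floorGuard F ((11·4+3·L)·L)) (lamDatum F) (dataSmall7PTopOf F 2) B₃ a₀ a₁` with `2L² ≤ B₃`, `0 < a₀`, `0 < a₁` (stub 1 `Prop8StepCoPAt F` opened), [6] Prop. 6 at NODE 00's member `B8.Prop6Printed 4 L B₁ c₁ (zdCub (MatA 2) L ·)` with `0 ≤ B₁`, `0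 < c₁` (stub 2 `Prop6MemberB8At F` opened), the thresholds `0 < ε₀`, `0 < ε₂₉` and the β-box at the cube witness `θ₁₅ᶜᶜᴹ(3; ε₀, ε₂₉; B₃, B₃', a₀, a₁')` for ANY gauge constant `B₃' ≥ b9Of·B₃` and ceiling `0 < a₁' ≤ min a₁ (a0Of∕B₃)` (V15's exact letters `B₃' := b9Of F L³ B₁ · B₃`, `a₁' := min a₁ (a0Of F 2 L³ B₁ c₁ ∕ B₃)` with `le_rfl`; stub 3′ `BetaBoxAtThm1WitnessCCMAt F`'s ∃-body opened) and `hm : 4 ≤ F.m` ((δ)); door provisos BY NAME (§0) through dag-n07-e's bridge `variationalThm1RegSepCoP7MGB_of_prop8TopStepGB_lamDatum`, dag-n21-c FILE C's `gauge9R_cube_of_prop8TopStep_of_prop6Member` and B′'s monotonicity `VariationalThm1GaugeRegSepCoP7MGB.mono ∕ .of_le` — AT THE V15 WITNESS `Stage13HParams.ofHistoryBlind ⟨θ₁₅ᶜᶜᴹ, ZrOfRecord₁₃ θ₁₅ᶜᶜᴹ⟩` (the history-blind door over the cured residual of the collared `θ₁₅ᶜᶜᴹ(j) = theta13OfThm1CCM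 F N j ε₀ ε₂₉ B₃ B₃' a₀ a₁`; `= ofHistoryBlind (Stage13RParams.ofCured θ₁₅ᶜᶜᴹ)`, `rfl`) — RUNG 1's BODY AT dag-n05-d's H-PIN** (`X' := XPinned₁₃H θ λ₈ λ₁₂ λ₁₃`): N05 ← `B8LeafOfRecordSubBH θ₃ λ₈`, N09 ← Lemma 4 at `F12OfRecord₁₂ θ₁₂ λ₁₂`, N10 ← `B13LeafOfRecord θ₃ (λ₁₃ P)`
(the previous theorem through the three `Iff.rfl` sockets and §0's `b8` reading). [cite: Balaban1989LargeFieldII, Thm 1 p.355, (0.1) pp.355–356, p.391; Balaban1985RegularSpaces, Thm 8 (1.146) p.101; Balaban1985UV3, Thm 1 p.257 + Thm 2 p.272; Balaban1989LargeFieldI, Prop. 1 p.194; Balaban1987RG1, Thm 3 p.264, Lemma 4 p.280; Balaban1988RG2Cluster, Lemmas 1–3 pp.9–20 (bookkeeping)] (= `N24_nodesAtSomeRecordS₁₃SepCoPH_of_pinX3HS_fourPin_pointed` at `θ := the door`; `Admissible` ← dag-n21-c `admissible_theta13OfThm1CCM` (six signs), `SlotsNondegenerate₁₃` ← dag-n21-c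 `slotsNondegenerate₁₃_theta13OfThm1CCM` (hypothesis-free), N13's (R₁₃) ← §0 `N24_laws₁₃CoPH_theta13OfThm1CCM` (= dag-n11-e's generic `rOpLeaf_VOfRecord₁₃CoPH_theta13LiveOfNumerics` at the member, six signs) — ALL BY NAME; the β-box pair `hlo ∕ hhi` read at the witness's β of record `betaOfRecord₁₃ F N θ₁₅ᶜᶜᴹ` (def-T `βfun_datumOfRecord₁₃SepCoPH`, `rfl`) = the currency of V15's stub 3′ `stub_betaBoxAtThm1WitnessCCM13` (there at `j = 3`, γ = 1∕2 = `θ₁₅ᶜᶜᴹ.γ`); the unity guard DISCHARGED by `Stage13RParams.ZrUnity.ofHistoryBlind` over K0a FILE 17 `finsum_ζ0_ZrOfRecord₁₃`; `hP : (…).Provisos₁₃SepCoPH F N` at the door — the K0⁷ skeleton's own product — is the ONLY K0-side hypothesis left.) (= `N24_nodesAtSomeRecordS₁₃SepCoPH_of_pinX3HS_fourPin_pointed_theta13OfThm1CCM_door` with `hP := §0`; signs `0 ≤ B₃` from the floor, `0 ≤ B₃'` from `0 ≤ b9Of·B₃ ≤ B₃'` (`b9Of_pos`); the WORLD's β-box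 letters `hlo ∕ hhi` (at `w.b`, `w.βup`, `w.γ ≤ ½`; present in the consequent ∕ rung-2 forms only) stay the closer's — at `w.γ = ½`, `w.b = b`, `w.βup = β'` they ARE the K0 box `hbox ∕ hbox'`.) -/
theorem N24_nodesAtSomeRecordS₁₃SepCoPH_of_pinX3HS_fourPin_pointed_theta13OfThm1CCM_cube_of_prop8TopStep_of_prop6Member_of_betaBox_door (hm : 4 ≤ F.m) {B₃ a₀ a₁ B₁ c₁ B₃' a₁' : ℝ} (hB₃ : 2 * (F.L : ℝ) ^ 2 ≤ B₃) (ha₀ : 0 < a₀)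
    (h8 : Prop8RegSepTopStepGB F 2 (fun ν K Ω => suppDomOfRecord F ν K Ω) (floorGuard F ((11 * 4 + 3 * F.L) * F.L)) (lamDatum F) (dataSmall7PTopOf F 2) B₃ a₀ a₁) (hB₁ : 0 ≤ B₁) (hc₁ : 0 < c₁)
    (hP6 : letI : CStarAlgebra (MatA 2) := {}; B8.Prop6Printed 4 (F.L : ℝ) B₁ c₁ (fun i : B8LeafModelZd.ZdIdx 4 F.L => zdCub (MatA 2) F.L i))
    (hB₉ : b9Of F (F.L ^ 3) B₁ * B₃ ≤ B₃') (ha₁' : 0 < a₁') (ha₁'le : a₁' ≤ min a₁ (a0Of F 2 (F.L ^ 3) B₁ c₁ / B₃))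
    {ε₀ ε₂₉ : ℝ} (hε : 0 < ε₀) (hε' : 0 < ε₂₉) {b β' : ℝ} (hb : 0 ≤ b) (hbox : BetaLowerH b (1 / 2) (betaOfRecord₁₃ F 2 (theta13OfThm1CCM F 2 3 ε₀ ε₂₉ B₃ B₃' a₀ a₁')))
    (hbox' : BetaUpperH β' (1 / 2) (betaOfRecord₁₃ F 2 (theta13OfThm1CCM F 2 3 ε₀ ε₂₉ B₃ B₃' a₀ a₁'))) (hβ' : β' ≤ 3)
    (lam8 : ResidB8 (theta13OfThm1CCM F 2 3 ε₀ ε₂₉ B₃ B₃' a₀ a₁').toStage3Params)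
    (lam12 : ResidB12 F 2 (theta13OfThm1CCM F 2 3 ε₀ ε₂₉ B₃ B₃' a₀ a₁').τ9.M)
    (lam13 : B12.RunParams → ResidB13 (theta13OfThm1CCM F 2 3 ε₀ ε₂₉ B₃ B₃' a₀ a₁').toStage3Params)
    (Mstar : ℕ)
    (ops : OpsY 2 (theta13OfThm1CCM F 2 3 ε₀ ε₂₉ B₃ B₃' a₀ a₁').toStage3Params Mstar)
    (ζ : ResidZ F 2)
    (lamW : ResidW F 2)
    (w : WorldP)
    (hC : w.C = (datumOfRecord₁₃SepCoPH F 2 (Stage13HParams.ofHistoryBlind F 2 ⟨theta13OfThm1CCM F 2 3 ε₀ ε₂₉ B₃ B₃' a₀ a₁', ZrOfRecord₁₃ F 2 (theta13OfThm1CCM F 2 3 ε₀ ε₂₉ B₃ B₃' a₀ a₁')⟩) (N24_provisos₁₃SepCoPH_door_theta13OfThm1CCM_cube_of_prop8TopStep_of_prop6Member_of_betaBox F hm hB₃ ha₀ h8 hB₁ hc₁ hP6 hB₉ ha₁' ha₁'le hε hε' hb hbox hbox' hβ')).C)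
    (hγ : 0 < w.γ ∧ w.γ ≤ (theta13OfThm1CCM F 2 3 ε₀ ε₂₉ B₃ B₃' a₀ a₁').γ)
    (hL : w.L = ((theta13OfThm1CCM F 2 3 ε₀ ε₂₉ B₃ B₃' a₀ a₁').L : ℝ))
    (hup : ∀ P, w.up P = upOfRecord₅CS F 2 (((Stage13HParams.ofHistoryBlind F 2 ⟨theta13OfThm1CCM F 2 3 ε₀ ε₂₉ B₃ B₃' a₀ a₁', ZrOfRecord₁₃ F 2 (theta13OfThm1CCM F 2 3 ε₀ ε₂₉ B₃ B₃' a₀ a₁')⟩).pinX3H F 2 lam8 lam12 lam13).view₁₃CoPHB10YZW F 2 Mstar ops ζ lamW) P)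
    (h05 : B8LeafOfRecordSubBH (theta13OfThm1CCM F 2 3 ε₀ ε₂₉ B₃ B₃' a₀ a₁').toStage3Params lam8)
    (h06 : B9LeafX (Y9OfRecord 2 (theta13OfThm1CCM F 2 3 ε₀ ε₂₉ B₃ B₃' a₀ a₁').toStage3Params Mstar ops))
    (h07 : B11Leaf (Z11OfRecord F 2 ζ))
    (h08 : PrintedUV3V 2 (theta13OfThm1CCM F 2 3 ε₀ ε₂₉ B₃ B₃' a₀ a₁').L)
    (h09 : ∀ P : B12.RunParams, B12Sec2to5.Lemma4Printed (F12OfRecord₁₂ F 2 (theta13OfThm1CCM F 2 3 ε₀ ε₂₉ B₃ B₃' a₀ a₁').toStage12Params lam12 P) (lam12 P).consts)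
    (h09T : ∀ P : B12.RunParams, (leavesP w P).smallCouplings → (leavesP w P).smallFieldInductive)
    (h10 : ∀ P : B12.RunParams, B13LeafOfRecord (theta13OfThm1CCM F 2 3 ε₀ ε₂₉ B₃ B₃' a₀ a₁').toStage3Params (lam13 P))
    (h11 : ∀ P : B12.RunParams, (leavesP w P).b7 → (leavesP w P).b8 → (leavesP w P).b9 → (leavesP w P).b10 → (leavesP w P).b11 →
      (leavesP w P).smallCouplings → (leavesP w P).smallFieldInductive → (leavesP w P).flowControl →
        ∀ k, k < P.K → SLaw₁₃CoPH F 2 (Stage13HParams.ofHistoryBlind F 2 ⟨theta13OfThm1CCM F 2 3 ε₀ ε₂₉ B₃ B₃' a₀ a₁', ZrOfRecord₁₃ F 2 (theta13OfThm1CCM F 2 3 ε₀ ε₂₉ B₃ B₃' a₀ a₁')⟩) P k → TLaw₁₃CoPH F 2 (Stage13HParams.ofHistoryBlind F 2 ⟨theta13OfThm1CCM F 2 3 ε₀ ε₂₉ B₃ B₃' a₀ a₁', ZrOfRecord₁₃ F 2 (theta13OfThm1CCM F 2 3 ε₀ ε₂₉ B₃ B₃' a₀ a₁')⟩) P k)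
    (h12 : ∀ P : B12.RunParams, B15Leaf (WOfRecord₁₃ F 2 (theta13OfThm1CCM F 2 3 ε₀ ε₂₉ B₃ B₃' a₀ a₁') lamW P))
    (hUV : ∀ P : B12.RunParams, (genFlow (betaOfRecord₁₃ F 2 (theta13OfThm1CCM F 2 3 ε₀ ε₂₉ B₃ B₃' a₀ a₁')) P.g0).InInterval w.γ P.K → ∀ k, k ≤ P.K → SLaw₁₃CoPH F 2 (Stage13HParams.ofHistoryBlind F 2 ⟨theta13OfThm1CCM F 2 3 ε₀ ε₂₉ B₃ B₃' a₀ a₁', ZrOfRecord₁₃ F 2 (theta13OfThm1CCM F 2 3 ε₀ ε₂₉ B₃ B₃' a₀ a₁')⟩) P k →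
      ∀ U : GaugeField (F.P P.K) k (SU 2),
        chiβOfRecord₁₃ F 2 (theta13OfThm1CCM F 2 3 ε₀ ε₂₉ B₃ B₃' a₀ a₁') P.K (gOfRecord₁₃ F 2 (theta13OfThm1CCM F 2 3 ε₀ ε₂₉ B₃ B₃' a₀ a₁') P) k U *
              Real.exp (-(1 / (gOfRecord₁₃ F 2 (theta13OfThm1CCM F 2 3 ε₀ ε₂₉ B₃ B₃' a₀ a₁') P k) ^ 2 * wilsonBGOfRecord F 2 (theta13OfThm1CCM F 2 3 ε₀ ε₂₉ B₃ B₃' a₀ a₁').εbg P k U)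
                - w.em (gOfRecord₁₃ F 2 (theta13OfThm1CCM F 2 3 ε₀ ε₂₉ B₃ B₃' a₀ a₁') P k) * (Fintype.card (Site (F.P P.K) k) : ℝ)) ≤ densOfRecord₁₃ F 2 (theta13OfThm1CCM F 2 3 ε₀ ε₂₉ B₃ B₃' a₀ a₁') P k U ∧
        densOfRecord₁₃ F 2 (theta13OfThm1CCM F 2 3 ε₀ ε₂₉ B₃ B₃' a₀ a₁') P k U ≤ Real.exp (w.ep (gOfRecord₁₃ F 2 (theta13OfThm1CCM F 2 3 ε₀ ε₂₉ B₃ B₃' a₀ a₁') P k) * (Fintype.card (Site (F.P P.K) k) : ℝ)))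
    (hK : ∀ P : B12.RunParams, 1 ≤ P.K → lamW.kSel P < P.K) :
    ∃ (θ : Stage13HParams F 2) (hP : θ.Provisos₁₃SepCoPH F 2) (w : WorldP), (θ.ZhUnity F 2 ∧ θ.SlotsNondegenerate₁₃ F 2) ∧ θ.Admissible F 2 ∧
      (∃ (θ' : Stage13HParams F 2) (h' : θ'.Provisos₁₃SepCoPH F 2), θ'.Admissible F 2 ∧
      datumOfRecord₁₃SepCoPH F 2 θ hP = datumOfRecord₁₃SepCoPH F 2 θ' h' ∧ w.C = (datumOfRecord₁₃SepCoPH F 2 θ hP).C ∧ (0 < w.γ ∧ w.γ ≤ θ'.γ) ∧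
      w.L = (θ'.L : ℝ) ∧ ∀ P : B12.RunParams, w.up P = upOfRecord₅CS F 2 (θ'.toStage5₁₃CoPH F 2) P) ∧
      (∀ P : B12.RunParams, Nodes (leavesP w P)) ∧ PrintedUV3V 2 θ.L ∧
      ∃ lam : ResidW F 2, (∀ P : B12.RunParams, 1 ≤ P.K → lam.kSel P < P.K) ∧
        ∀ P : B12.RunParams, lam.kSel P < P.K → ((leavesP w P).rBasicStep ↔ B15Leaf (WOfRecord₁₃ F 2 θ.toStage13Params lam P)) := by
  have hL0 : (0 : ℝ) < (F.L : ℝ) := by exact_mod_cast lt_trans Nat.zero_lt_one F.hL.2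
  have hBpos : (0 : ℝ) < B₃ := lt_of_lt_of_le (mul_pos two_pos (pow_pos hL0 2)) hB₃
  have hB9 : (0 : ℝ) ≤ B₃' := (mul_nonneg (b9Of_pos (F := F) (F.L ^ 3) hB₁).le hBpos.le).trans hB₉
  exact N24_nodesAtSomeRecordS₁₃SepCoPH_of_pinX3HS_fourPin_pointed_theta13OfThm1CCM_door (F := F) (N := 2) hε hε' hBpos.le hB9 ha₀ ha₁' (N24_provisos₁₃SepCoPH_door_theta13OfThm1CCM_cube_of_prop8TopStep_of_prop6Member_of_betaBox F hm hB₃ ha₀ h8 hB₁ hc₁ hP6 hB₉ ha₁' ha₁'le hε hε' hb hbox hbox' hβ') lam8 lam12 lam13 Mstar ops ζ lamW w hC hγ hL hup h05 h06 h07 h08 h09 h09T h10 h11 h12 hUV hK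

/-- **AT THE V15 WITNESS ON PRINT's RANGE `4 ≤ F.m`, `N = 2`, `j = 3`, WITH `hP` DISCHARGED MODULO EXACTLY plan g76's V15 STUB BODIES** — [15] Prop. 8's top step `Prop8RegSepTopStepGB F 2 suppDom (floorGuard F ((11·4+3·L)·L)) (lamDatum F) (dataSmall7PTopOf F 2) B₃ a₀ a₁` with `2L² ≤ B₃`, `0 < a₀`, `0 < a₁` (stub 1 `Prop8StepCoPAt F` opened), [6] Prop. 6 at NODE 00's member `B8.Prop6Printed 4 L B₁ c₁ (zdCub (MatA 2) L ·)` with `0 ≤ B₁`, `0 < c₁` (stub 2 `Prop6MemberB8At F` opened), the thresholds `0 < ε₀`, `0 < ε₂₉` and the β-box at the cube witness `θ₁₅ᶜᶜᴹ(3; ε₀, ε₂₉; B₃, B₃', a₀, a₁')` for ANY gauge constant `B₃' ≥ b9Of·B₃` and ceiling `0 < a₁' ≤ min a₁ (a0Of∕B₃)` (V15's exact letters `B₃' := b9Of F L³ B₁ · B₃`, `a₁' := min a₁ (a0Of F 2 L³ B₁ c₁ ∕ B₃)` with `le_rfl`; stub 3′ `BetaBoxAtThm1WitnessCCMAt F`'s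 ∃-body opened) and `hm : 4 ≤ F.m` ((δ)); door provisos BY NAME (§0) through dag-n07-e's bridge `variationalThm1RegSepCoP7MGB_of_prop8TopStepGB_lamDatum`, dag-n21-c FILE C's `gauge9R_cube_of_prop8TopStep_of_prop6Member` and B′'s monotonicity `VariationalThm1GaugeRegSepCoP7MGB.mono ∕ .of_le` — AT THE V15 WITNESS `Stage13HParams.ofHistoryBlind ⟨θ₁₅ᶜᶜᴹ, ZrOfRecord₁₃ θ₁₅ᶜᶜᴹ⟩` (the history-blind door over the cured residual of the collared `θ₁₅ᶜᶜᴹ(j) = theta13OfThm1CCM F N j ε₀ ε₂₉ B₃ B₃' a₀ a₁`; `= ofHistoryBlind (Stage13RParams.ofCured θ₁₅ᶜᶜᴹ)`, `rfl`) — RUNG 2's BODY AT dag-n05-d's H-PIN** (`X' := XPinned₁₃H θ λ₈ λ₁₂ λ₁₃`), from the pointed children on N05's surviving route and the β-box pair.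
[cite: Balaban1989LargeFieldII, Thm 1 p.355, (0.1) pp.355–356, p.391; Balaban1987RG1, Thm 3 p.264, (0.17)–(0.20) pp.255–256 and (1.22) p.264; Balaban1985RegularSpaces, Thm 8 (1.146) p.101 (bookkeeping + elementary window)] (= `N24_betaWindowAtSomeRecordS₁₃SepCoPH_of_pinX3HS_fourPin_pointed_of_boxH` at `θ := the door`; `Admissible` ← dag-n21-c `admissible_theta13OfThm1CCM` (six signs), `SlotsNondegenerate₁₃` ← dag-n21-c `slotsNondegenerate₁₃_theta13OfThm1CCM` (hypothesis-free), N13's (R₁₃) ← §0 `N24_laws₁₃CoPH_theta13OfThm1CCM` (= dag-n11-e's generic `rOpLeaf_VOfRecord₁₃CoPH_theta13LiveOfNumerics` at the member, six signs) — ALL BY NAME; the β-box pair `hlo ∕ hhi` read at the witness's β of record `betaOfRecord₁₃ F N θ₁₅ᶜᶜᴹ` (def-T `βfun_datumOfRecord₁₃SepCoPH`, `rfl`) = the currency of V15's stub 3′ `stub_betaBoxAtThm1WitnessCCM13` (there at `j = 3`, γ = 1∕2 = `θ₁₅ᶜᶜᴹ.γ`); the unity guard DISCHARGED by `Stage13RParams.ZrUnity.ofHistoryBlind`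 over K0a FILE 17 `finsum_ζ0_ZrOfRecord₁₃`; `hP : (…).Provisos₁₃SepCoPH F N` at the door — the K0⁷ skeleton's own product — is the ONLY K0-side hypothesis left.) (= `N24_betaWindowAtSomeRecordS₁₃SepCoPH_of_pinX3HS_fourPin_pointed_of_boxH_theta13OfThm1CCM_door` with `hP := §0`; signs `0 ≤ B₃` from the floor, `0 ≤ B₃'` from `0 ≤ b9Of·B₃ ≤ B₃'` (`b9Of_pos`); the WORLD's β-box letters `hlo ∕ hhi` (at `w.b`, `w.βup`, `w.γ ≤ ½`; present in the consequent ∕ rung-2 forms only) stay the closer's — at `w.γ = ½`, `w.b = b`, `w.βup = β'` they ARE the K0 box `hbox ∕ hbox'`.) -/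
theorem N24_betaWindowAtSomeRecordS₁₃SepCoPH_of_pinX3HS_fourPin_pointed_of_boxH_theta13OfThm1CCM_cube_of_prop8TopStep_of_prop6Member_of_betaBox_door (hm : 4 ≤ F.m) {B₃ a₀ a₁ B₁ c₁ B₃' a₁' : ℝ} (hB₃ : 2 * (F.L : ℝ) ^ 2 ≤ B₃) (ha₀ : 0 < a₀)
    (h8 : Prop8RegSepTopStepGB F 2 (fun ν K Ω => suppDomOfRecord F ν K Ω) (floorGuard F ((11 * 4 + 3 * F.L) * F.L)) (lamDatum F) (dataSmall7PTopOf F 2) B₃ a₀ a₁) (hB₁ : 0 ≤ B₁) (hc₁ : 0 < c₁)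
    (hP6 : letI : CStarAlgebra (MatA 2) := {}; B8.Prop6Printed 4 (F.L : ℝ) B₁ c₁ (fun i : B8LeafModelZd.ZdIdx 4 F.L => zdCub (MatA 2) F.L i))
    (hB₉ : b9Of F (F.L ^ 3) B₁ * B₃ ≤ B₃') (ha₁' : 0 < a₁') (ha₁'le : a₁' ≤ min a₁ (a0Of F 2 (F.L ^ 3) B₁ c₁ / B₃))
    {ε₀ ε₂₉ : ℝ} (hε : 0 < ε₀) (hε' : 0 < ε₂₉) {b β' : ℝ} (hb : 0 ≤ b) (hbox : BetaLowerH b (1 / 2) (betaOfRecord₁₃ F 2 (theta13OfThm1CCM F 2 3 ε₀ ε₂₉ B₃ B₃' a₀ a₁')))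
    (hbox' : BetaUpperH β' (1 / 2) (betaOfRecord₁₃ F 2 (theta13OfThm1CCM F 2 3 ε₀ ε₂₉ B₃ B₃' a₀ a₁'))) (hβ' : β' ≤ 3)
    (lam8 : ResidB8 (theta13OfThm1CCM F 2 3 ε₀ ε₂₉ B₃ B₃' a₀ a₁').toStage3Params)
    (lam12 : ResidB12 F 2 (theta13OfThm1CCM F 2 3 ε₀ ε₂₉ B₃ B₃' a₀ a₁').τ9.M)
    (lam13 : B12.RunParams → ResidB13 (theta13OfThm1CCM F 2 3 ε₀ ε₂₉ B₃ B₃' a₀ a₁').toStage3Params)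
    (Mstar : ℕ)
    (ops : OpsY 2 (theta13OfThm1CCM F 2 3 ε₀ ε₂₉ B₃ B₃' a₀ a₁').toStage3Params Mstar)
    (ζ : ResidZ F 2)
    (lamW : ResidW F 2)
    (w : WorldP)
    (hC : w.C = (datumOfRecord₁₃SepCoPH F 2 (Stage13HParams.ofHistoryBlind F 2 ⟨theta13OfThm1CCM F 2 3 ε₀ ε₂₉ B₃ B₃' a₀ a₁', ZrOfRecord₁₃ F 2 (theta13OfThm1CCM F 2 3 ε₀ ε₂₉ B₃ B₃' a₀ a₁')⟩) (N24_provisos₁₃SepCoPH_door_theta13OfThm1CCM_cube_of_prop8TopStep_of_prop6Member_of_betaBox F hm hB₃ ha₀ h8 hB₁ hc₁ hP6 hB₉ ha₁' ha₁'le hε hε' hb hbox hbox' hβ')).C)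
    (hγ : 0 < w.γ ∧ w.γ ≤ (theta13OfThm1CCM F 2 3 ε₀ ε₂₉ B₃ B₃' a₀ a₁').γ)
    (hL : w.L = ((theta13OfThm1CCM F 2 3 ε₀ ε₂₉ B₃ B₃' a₀ a₁').L : ℝ))
    (hup : ∀ P, w.up P = upOfRecord₅CS F 2 (((Stage13HParams.ofHistoryBlind F 2 ⟨theta13OfThm1CCM F 2 3 ε₀ ε₂₉ B₃ B₃' a₀ a₁', ZrOfRecord₁₃ F 2 (theta13OfThm1CCM F 2 3 ε₀ ε₂₉ B₃ B₃' a₀ a₁')⟩).pinX3H F 2 lam8 lam12 lam13).view₁₃CoPHB10YZW F 2 Mstar ops ζ lamW) P)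
    (h05 : B8LeafOfRecordSubBH (theta13OfThm1CCM F 2 3 ε₀ ε₂₉ B₃ B₃' a₀ a₁').toStage3Params lam8)
    (h06 : B9LeafX (Y9OfRecord 2 (theta13OfThm1CCM F 2 3 ε₀ ε₂₉ B₃ B₃' a₀ a₁').toStage3Params Mstar ops))
    (h07 : B11Leaf (Z11OfRecord F 2 ζ))
    (h08 : PrintedUV3V 2 (theta13OfThm1CCM F 2 3 ε₀ ε₂₉ B₃ B₃' a₀ a₁').L)
    (h09 : ∀ P : B12.RunParams, B12Sec2to5.Lemma4Printed (F12OfRecord₁₂ F 2 (theta13OfThm1CCM F 2 3 ε₀ ε₂₉ B₃ B₃' a₀ a₁').toStage12Params lam12 P) (lam12 P).consts)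
    (h09T : ∀ P : B12.RunParams, (leavesP w P).smallCouplings → (leavesP w P).smallFieldInductive)
    (h10 : ∀ P : B12.RunParams, B13LeafOfRecord (theta13OfThm1CCM F 2 3 ε₀ ε₂₉ B₃ B₃' a₀ a₁').toStage3Params (lam13 P))
    (h11 : ∀ P : B12.RunParams, (leavesP w P).b7 → (leavesP w P).b8 → (leavesP w P).b9 → (leavesP w P).b10 → (leavesP w P).b11 →
      (leavesP w P).smallCouplings → (leavesP w P).smallFieldInductive → (leavesP w P).flowControl →
        ∀ k, k < P.K → SLaw₁₃CoPH F 2 (Stage13HParams.ofHistoryBlind F 2 ⟨theta13OfThm1CCM F 2 3 ε₀ ε₂₉ B₃ B₃' a₀ a₁', ZrOfRecord₁₃ F 2 (theta13OfThm1CCM F 2 3 ε₀ ε₂₉ B₃ B₃' a₀ a₁')⟩) P k → TLaw₁₃CoPH F 2 (Stage13HParams.ofHistoryBlind F 2 ⟨theta13OfThm1CCM F 2 3 ε₀ ε₂₉ B₃ B₃' a₀ a₁', ZrOfRecord₁₃ F 2 (theta13OfThm1CCM F 2 3 ε₀ ε₂₉ B₃ B₃' a₀ a₁')⟩) P k)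
    (h12 : ∀ P : B12.RunParams, B15Leaf (WOfRecord₁₃ F 2 (theta13OfThm1CCM F 2 3 ε₀ ε₂₉ B₃ B₃' a₀ a₁') lamW P))
    (hUV : ∀ P : B12.RunParams, (genFlow (betaOfRecord₁₃ F 2 (theta13OfThm1CCM F 2 3 ε₀ ε₂₉ B₃ B₃' a₀ a₁')) P.g0).InInterval w.γ P.K → ∀ k, k ≤ P.K → SLaw₁₃CoPH F 2 (Stage13HParams.ofHistoryBlind F 2 ⟨theta13OfThm1CCM F 2 3 ε₀ ε₂₉ B₃ B₃' a₀ a₁', ZrOfRecord₁₃ F 2 (theta13OfThm1CCM F 2 3 ε₀ ε₂₉ B₃ B₃' a₀ a₁')⟩) P k →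
      ∀ U : GaugeField (F.P P.K) k (SU 2),
        chiβOfRecord₁₃ F 2 (theta13OfThm1CCM F 2 3 ε₀ ε₂₉ B₃ B₃' a₀ a₁') P.K (gOfRecord₁₃ F 2 (theta13OfThm1CCM F 2 3 ε₀ ε₂₉ B₃ B₃' a₀ a₁') P) k U *
              Real.exp (-(1 / (gOfRecord₁₃ F 2 (theta13OfThm1CCM F 2 3 ε₀ ε₂₉ B₃ B₃' a₀ a₁') P k) ^ 2 * wilsonBGOfRecord F 2 (theta13OfThm1CCM F 2 3 ε₀ ε₂₉ B₃ B₃' a₀ a₁').εbg P k U)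
                - w.em (gOfRecord₁₃ F 2 (theta13OfThm1CCM F 2 3 ε₀ ε₂₉ B₃ B₃' a₀ a₁') P k) * (Fintype.card (Site (F.P P.K) k) : ℝ)) ≤ densOfRecord₁₃ F 2 (theta13OfThm1CCM F 2 3 ε₀ ε₂₉ B₃ B₃' a₀ a₁') P k U ∧
        densOfRecord₁₃ F 2 (theta13OfThm1CCM F 2 3 ε₀ ε₂₉ B₃ B₃' a₀ a₁') P k U ≤ Real.exp (w.ep (gOfRecord₁₃ F 2 (theta13OfThm1CCM F 2 3 ε₀ ε₂₉ B₃ B₃' a₀ a₁') P k) * (Fintype.card (Site (F.P P.K) k) : ℝ)))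
    (hlo : BetaLowerH w.b w.γ (betaOfRecord₁₃ F 2 (theta13OfThm1CCM F 2 3 ε₀ ε₂₉ B₃ B₃' a₀ a₁')))
    (hhi : BetaUpperH w.βup w.γ (betaOfRecord₁₃ F 2 (theta13OfThm1CCM F 2 3 ε₀ ε₂₉ B₃ B₃' a₀ a₁'))) :
    ∃ (θ : Stage13HParams F 2) (hP : θ.Provisos₁₃SepCoPH F 2) (w : WorldP), (θ.ZhUnity F 2 ∧ θ.SlotsNondegenerate₁₃ F 2) ∧ θ.Admissible F 2 ∧
      (∃ (θ' : Stage13HParams F 2) (h' : θ'.Provisos₁₃SepCoPH F 2), θ'.Admissible F 2 ∧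
      datumOfRecord₁₃SepCoPH F 2 θ hP = datumOfRecord₁₃SepCoPH F 2 θ' h' ∧ w.C = (datumOfRecord₁₃SepCoPH F 2 θ hP).C ∧ (0 < w.γ ∧ w.γ ≤ θ'.γ) ∧
      w.L = (θ'.L : ℝ) ∧ ∀ P : B12.RunParams, w.up P = upOfRecord₅CS F 2 (θ'.toStage5₁₃CoPH F 2) P) ∧
      (∀ P : B12.RunParams, Nodes (leavesP w P)) ∧ BetaBoundsInInterval w.C.toB12 w.γ w.b w.βup ∧
      ∃ γ₁ : ℝ, 0 < γ₁ ∧ ∀ γ : ℝ, 0 < γ → γ ≤ γ₁ → ∃ P : B12.RunParams, 1 ≤ P.K ∧ ((datumOfRecord₁₃SepCoPH F 2 θ hP).C P).flow.InInterval γ P.K := by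
  have hL0 : (0 : ℝ) < (F.L : ℝ) := by exact_mod_cast lt_trans Nat.zero_lt_one F.hL.2
  have hBpos : (0 : ℝ) < B₃ := lt_of_lt_of_le (mul_pos two_pos (pow_pos hL0 2)) hB₃
  have hB9 : (0 : ℝ) ≤ B₃' := (mul_nonneg (b9Of_pos (F := F) (F.L ^ 3) hB₁).le hBpos.le).trans hB₉
  exact N24_betaWindowAtSomeRecordS₁₃SepCoPH_of_pinX3HS_fourPin_pointed_of_boxH_theta13OfThm1CCM_door (F := F) (N := 2) hε hε' hBpos.le hB9 ha₀ ha₁' (N24_provisos₁₃SepCoPH_door_theta13OfThm1CCM_cube_of_prop8TopStep_of_prop6Member_of_betaBox F hm hB₃ ha₀ h8 hB₁ hc₁ hP6 hB₉ ha₁' ha₁'le hε hε' hb hbox hbox' hβ') lam8 lam12 lam13 Mstar ops ζ lamW w hC hγ hL hup h05 h06 h07 h08 h09 h09T h10 h11 h12 hUV hlo hhi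

end Summit.QuantumFields.YangMills.BalabanUVNodes.N24AtThm1CCMDoorOfStepTokensB

end
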